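import Summits.CriticalPhenomena.PercolationContinuityZ3.Theses.PercNearOneGluing
import Literature.Probability.Percolation.PercolationEvents
import Literature.Probability.Percolation.SharpnessDCTProofs
import Summits.CriticalPhenomena.PercolationContinuityZ3.Theorems.PercNearOneGluingNearOneGluingPocketLaplace
import Summits.CriticalPhenomena.PercolationContinuityZ3.Theorems.PercNearOneGluingNearOneGluingNoAttachAll
import Summits.CriticalPhenomena.PercolationContinuityZ3.Theorems.PercNearOneGluingNearOneGluingFiniteJensen
import Summits.CriticalPhenomena.PercolationContinuityZ3.Theorems.PercNearOneGluingNearOneGluingCrossingSeals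
import Summits.CriticalPhenomena.PercolationContinuityZ3.Theorems.PercNearOneGluingNearOneGluingLrfGlue
import Summits.CriticalPhenomena.PercolationContinuityZ3.Theorems.PercNearOneGluingNearOneGluingLrfDepthOneStatic
import Summits.CriticalPhenomena.PercolationContinuityZ3.Theorems.PercNearOneGluingNearOneGluingMaxattTwo
import Summits.CriticalPhenomena.PercolationContinuityZ3.Theorems.PercNearOneGluingNearOneGluingMaxattGlue
import Summits.CriticalPhenomena.PercolationContinuityZ3.Theorems.PercNearOneGluingNearOneGluingMaxattOfGl3
import Summits.CriticalPhenomena.PercolationContinuityZ3.Theorems.PercNearOneGluingNearOneGluingGl3OfReliableSource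
import Summits.CriticalPhenomena.PercolationContinuityZ3.Theorems.PercNearOneGluingNearOneGluingAttachRescueNegCorr
import Summits.CriticalPhenomena.PercolationContinuityZ3.Theorems.PercNearOneGluingNearOneGluingAttachAloneRescueBound
import Summits.CriticalPhenomena.PercolationContinuityZ3.Theorems.PercNearOneGluingNearOneGluingRescueTwo
import Summits.CriticalPhenomena.PercolationContinuityZ3.Theorems.PercNearOneGluingNearOneGluingMaxattTwoStrong
import Summits.CriticalPhenomena.PercolationContinuityZ3.Theorems.PercNearOneGluingNearOneGluingMaxattOfRescue
import Summits.CriticalPhenomena.PercolationContinuityZ3.Theorems.PercNearOneGluingNearOneGluingAttachSetRescueNegCorr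
import Summits.CriticalPhenomena.PercolationContinuityZ3.Theorems.PercNearOneGluingNearOneGluingAttachAloneSetRescueBound
import Summits.CriticalPhenomena.PercolationContinuityZ3.Theorems.PercNearOneGluingNearOneGluingTieLemma
import Summits.CriticalPhenomena.PercolationContinuityZ3.Theorems.PercNearOneGluingNearOneGluingQ7ThreeOfExch
import Summits.CriticalPhenomena.PercolationContinuityZ3.Theorems.PercNearOneGluingNearOneGluingExch0
import Summits.CriticalPhenomena.PercolationContinuityZ3.Theorems.PercNearOneGluingNearOneGluingU1M
import Summits.CriticalPhenomena.PercolationContinuityZ3.Theorems.PercNearOneGluingNearOneGluingS2OfS2M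
import Summits.CriticalPhenomena.PercolationContinuityZ3.Theorems.PercNearOneGluingNearOneGluingS1OfCexch
import Summits.CriticalPhenomena.PercolationContinuityZ3.Theorems.PercNearOneGluingNearOneGluingExchStubsOfInnerHole
import HarnessLib.Audit

/-!
# Line `SketchR2I5` (live-fraction / finger–Laplace identity) — skeleton for the crux
`PercNearOneGluing.NearOneGluing` (item stmt-CriticalPhenomena-4574 = Kozma–Nitzan Conjecture 3,
arXiv:2401.12397 p.15, typed over all finite weighted graphs; route `route-CriticalPhenomena-PercNearOneGluing`).

Lead prover-line-stmt-CriticalPhenomena-4574-c1-0, 2026-08-16.  Built from `Cruxes/NearOneGluing/SketchR2I5.lean`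
(crux-ideate r2, ideator 5: FingerIdentity, DeadFingerBound, LiveFractionConcentration) with ONE repair found at L0:
the sketch's K2 `LiveFractionConcentration` is FALSE as typed (no bad event, no unreliability of `o`; 4-vertex
witness `o–a₁ (1−δ₀), a₁–b (1), o–a₂ (1−δ₀/2)`, see `Lines/SketchR2I5.md`), so the residual below keeps the Laplace
weight, i.e. is intersected with the bad event — which is exactly what the finger identity delivers.

## Objects (one finite weighted graph; no new definitions — everything is displayed)
`μ = prodBernoulli w` on bond configurations `ω : Set (Sym2 (Fin n))`; relay set `A`, source `o ∉ A`, target `b`;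
abstract POCKET SELECTOR `P` with `v ∈ P ω ↔ ω ∈ openConnIn (↑A)ᶜ o v` (the relay-free pocket `S₀` of `o`, binder
style of the landed `liveSeal_exposureBound`); for a vertex set `T` and a relay `a`,
`q_a(T) := ∏_{x ∈ T} (1 − w s(x,a))` (probability that `a` is NOT attached to `T` by an open pocket-to-relay pair),
`allProd(T) := ∏_{a ∈ A} q_a(T) = e^{−Λ(T)}`, and for a configuration `ω`,
`liveProd(T, ω) := ∏_{a ∈ A, a ↔ b off T} q_a(T) = e^{−Λ_live(T, ω)}` ("live" = `openConnIn (↑T)ᶜ a b`).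
Bad event `bad = {o ↮ b} ∩ {o ↔ A}`.

## The line in one paragraph
Partition `bad` by the pocket value `T = P ω` (`o ∈ T ∌ b`, `T ∩ A = ∅`).  Given `{P = T}` (determined by the pairs
inside `(↑A)ᶜ` meeting `T`), the pocket-to-relay pairs and the pairs avoiding `T` are FRESH and mutually independent,
and `o ↔ b` iff some relay ATTACHED to `T` is LIVE off `T`; hence for every event `D` determined off `T`,
`μ({o ↮ b} ∩ {P = T} ∩ D) ≤ μ(P = T) · ∫_D liveProd(T, ·) dμ` (stub 1, the one-sided finger/Laplace inequality) and
`Σ_T μ(P = T) · allProd(T) ≤ μ(o ↮ A)` (stub 2, no attached relay ⇒ `o ↮ A`).  On the event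
`J_c = {liveProd ≤ allProd^c}` ("at least a `c`-fraction of the pocket's relay-attachment weight is live",
`Λ_live ≥ c Λ`) this gives, with finite Jensen for `x ↦ x^c` (stub 3),
`μ({o ↮ b} ∩ J_c) ≤ Σ_T μ(P=T) allProd(T)^c ≤ (Σ_T μ(P=T) allProd(T))^c ≤ μ(o ↮ A)^c ≤ δ^c` — an `|A|`-FREE bound,
no entropy (the pocket law is a probability distribution): theorem `bad_inter_liveLarge_le` below (real proof from
stubs 1–3).  What is left is the complementary piece `μ(bad ∩ J_cᶜ) ≤ ε` (stub 4 = the residual, held by the lead):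
bad configurations whose pocket has LESS than a `c`-fraction of its attachment weight on live relays.  It is
crux-equivalent given stubs 1–3 (the event lies in `{o ↮ b}`).
Composition: `μ(o ↮ b) ≤ μ(o ↮ A) + μ({o ↮ b} ∩ J_{1/2}) + μ(bad ∩ J_{1/2}ᶜ) ≤ δ + √δ + ε/3 < ε`.

## Stubs (4, registered; all over existing Literature / route declarations)
* `stub_pocketLaplace` (M–L) — one-sided finger inequality at a fixed pocket value with an outside event. LANDED p98332.
* `stub_noAttachAll` (M) — `Σ_T μ(P = T)·allProd(T) ≤ μ(o ↮ A)`. LANDED p98239.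
* `stub_finiteJensen` (S) — `Σ μ_i x_i^c ≤ (Σ μ_i x_i)^c` for sub-probability weights, `x_i ≥ 0`, `0 < c ≤ 1`. LANDED p97920.
* `stub_liveFractionRare` — THE RESIDUAL (lead): `∀ ε c ∃ δ`, hyps(δ) ⇒ `μ(bad ∩ {allProd^c < liveProd}) ≤ ε`.
* `NearOneGluing_of : NearOneGluing` — kernel-checked composition (real proof).

## Disproof used (tree `Cruxes/NearOneGluing/Disproof.lean` v8)
§2 load-bearing hypotheses honoured (stub 2 spends `μ(o ↮ A)`, the residual carries reliability); §7 C8 / §9 pocket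
decomposition are the law-level shadows of stub 1; §8 saturation may be assumed inside the residual; Targets
(`stub_doomWindow`, `stub_giantPocketsRare`) not reused.  BarrierSharedBit: stub 1 spends disjoint-support
independence (pocket / attachment / outside pairs), unavailable in the shared-bit model.
-/

namespace Summit.CriticalPhenomena.PercolationContinuityZ3.Cruxes.NearOneGluing.LiveFractionLaplace

open MeasureTheory Set Literature.Probability.LatticeModels Literature.Probability.Percolation
open scoped Classical BigOperators

/-! ## Stub 1 — the one-sided finger / Laplace inequality at a fixed pocket value -/

/-- STUB 1 (size M–L; sources: SketchR2I5 `FingerIdentity`; the landed `exposureDecomp` /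
`liveSeal_exposureBound` (Theorems/PercNearOneGluingNearOneGluingExposureDecomp.lean, …Sprinkled.lean) for the
class/outside factorisation technology; `prodBernoulli_real_inter_of_determinedBy_disjoint`,
`prodBernoulli_real_forall_notMem`).
**Pocket Laplace bound.** Let `P` be the relay-free pocket selector, `o ∉ A`, `T ∌ b` a vertex set and `D` an event
determined by the pairs avoiding `T` (`{e | ∀ x ∈ T, x ∉ e}`).  Then
`μ({o ↮ b} ∩ {P = T} ∩ D) ≤ μ{P = T} · ∫_D ∏_{a ∈ A, a ↔ b off T} ∏_{x ∈ T} (1 − w s(x,a)) dμ`.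
Proof route: on `{P = T}` every pair from `T` to a non-relay outside `T` is closed, so an open `o–b` path leaves `T`
for the last time through an open pair `s(x,a)`, `x ∈ T`, `a ∈ A`, after which `a ↔ b` off `T`; hence
`{o ↮ b} ∩ {P = T} ⊆ {P = T} ∩ {∀ a ∈ A, (a ↔ b off T) → ∀ x ∈ T, s(x,a) ∉ ω}` (contrapositive: an attached live relay
joins `o` to `b`).  The three pair families — pairs inside `(↑A)ᶜ` meeting `T` (determine `{P = T}`), pairs
`s(x,a)`, `x ∈ T`, `a ∈ A` (attachment), pairs avoiding `T` (determine `D` and liveness) — are pairwise disjoint, so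
`μ` factorises; for a fixed outside configuration with live set `L` the attachment event has probability
`∏_{a ∈ L} ∏_{x ∈ T} (1 − w s(x,a))` (`prodBernoulli_real_forall_notMem`). -/
theorem stub_pocketLaplace :
    ∀ (n : ℕ) (w : Sym2 (Fin n) → unitInterval) (A : Finset (Fin n)) (o b : Fin n), o ∉ A →
      ∀ (P : Set (Sym2 (Fin n)) → Finset (Fin n)),
        (∀ ω v, v ∈ P ω ↔ ω ∈ openConnIn ((↑A : Set (Fin n))ᶜ) o v) →
      ∀ (T : Finset (Fin n)), b ∉ T →
      ∀ (D : Set (Set (Sym2 (Fin n)))), DeterminedBy D {e | ∀ x ∈ T, x ∉ e} →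
        (prodBernoulli w).real ({ω | ω ∉ openConn o b ∧ P ω = T} ∩ D) ≤
          (prodBernoulli w).real {ω | P ω = T} *
            ∫ ω in D, (∏ a ∈ A.filter (fun a => ω ∈ openConnIn ((↑T : Set (Fin n))ᶜ) a b),
                ∏ x ∈ T, (1 - (w s(x, a) : ℝ))) ∂(prodBernoulli w) :=
  Summit.CriticalPhenomena.PercolationContinuityZ3.Theorems.stub_pocketLaplace

/-! ## Stub 2 — no attached relay means `o ↮ A` -/

/-- STUB 2 (size M; sources: SketchR2I5 `FingerIdentity` (the `μ(o ↮ A)` identity); landed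
`exposureDecomp_exists_attached` (first exit of an open `o–a` path from the pocket goes to a relay);
`prodBernoulli_real_inter_of_determinedBy_disjoint`, `prodBernoulli_real_forall_notMem`).
**No-attachment bound.** With `P` the relay-free pocket selector and `o ∉ A`,
`Σ_T μ{P = T} · ∏_{a ∈ A} ∏_{x ∈ T} (1 − w s(x,a)) ≤ μ(o ↮ A)`.
Proof route: `μ{P = T} · ∏_a ∏_x (1 − w s(x,a)) = μ({P = T} ∩ {all pairs s(x,a), x ∈ T, a ∈ A, closed})`
(independence: `{P = T}` is determined by the pairs inside `(↑A)ᶜ` meeting `T`, disjoint from the attachment pairs),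
this event is contained in `{o ↮ A}` (an open `o–a` path would leave the pocket through an open attachment pair),
and the events `{P = T}` are pairwise disjoint in `T`. -/
theorem stub_noAttachAll :
    ∀ (n : ℕ) (w : Sym2 (Fin n) → unitInterval) (A : Finset (Fin n)) (o : Fin n), o ∉ A →
      ∀ (P : Set (Sym2 (Fin n)) → Finset (Fin n)),
        (∀ ω v, v ∈ P ω ↔ ω ∈ openConnIn ((↑A : Set (Fin n))ᶜ) o v) →
        ∑ T : Finset (Fin n), (prodBernoulli w).real {ω | P ω = T} *
            ∏ a ∈ A, ∏ x ∈ T, (1 - (w s(x, a) : ℝ)) ≤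
          (prodBernoulli w).real (⋃ a ∈ A, openConn o a)ᶜ :=
  Summit.CriticalPhenomena.PercolationContinuityZ3.Theorems.stub_noAttachAll

/-! ## Stub 3 — finite Jensen for `x ↦ x ^ c`, `0 < c ≤ 1`, with sub-probability weights -/

/-- STUB 3 (size S; sources: Mathlib concavity of `Real.rpow` for exponents in `[0,1]`
(`Real.concaveOn_rpow` / `NNReal.rpow_…`), `ConcaveOn.le_map_sum`).
**Finite Jensen, sub-probability form.** For nonnegative weights `m i` with `Σ m i ≤ 1`, nonnegative `x i` and
`0 < c ≤ 1`: `Σ m i · (x i)^c ≤ (Σ m i · x i)^c`.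
Proof route: if `M := Σ m i = 0` both sides vanish termwise; else Jensen for the concave `t ↦ t^c` with the
probability weights `m i / M` gives `Σ m i (x i)^c ≤ M · (Σ (m i/M) x i)^c = M^{1−c} (Σ m i x i)^c ≤ (Σ m i x i)^c`. -/
theorem stub_finiteJensen :
    ∀ {ι : Type*} (s : Finset ι) (m x : ι → ℝ) (c : ℝ), 0 < c → c ≤ 1 →
      (∀ i ∈ s, 0 ≤ m i) → (∑ i ∈ s, m i ≤ 1) → (∀ i ∈ s, 0 ≤ x i) →
        ∑ i ∈ s, m i * (x i) ^ c ≤ (∑ i ∈ s, m i * x i) ^ c :=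
  Summit.CriticalPhenomena.PercolationContinuityZ3.Theorems.stub_finiteJensen

/-! ## Stub 4 — THE RESIDUAL (lead): bad pockets with a small live fraction of attachment weight are rare -/

/-- STUB 4 — HARDEST, the residual (open-problem grade; crux-equivalent given stubs 1–3: the displayed event is
contained in `{o ↮ b}`, so `NearOneGluing` implies it, and `NearOneGluing_of` below is the converse).
**Live-fraction rarity (Laplace-weighted form of SketchR2I5's K2).** For every `ε > 0` and `c ∈ (0,1)` there is
`δ > 0` such that on every finite weighted graph with `μ(o ↮ A) ≤ δ` and `μ(a ↮ b) ≤ δ` for all `a ∈ A` (`o ∉ A`,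
`o ≠ b`), the bad configurations whose relay-free pocket `S₀ = P ω` has LESS than a `c`-fraction of its
relay-attachment weight on live relays — `(∏_{a∈A} q_a(S₀))^c < ∏_{a live off S₀} q_a(S₀)`, i.e. `Λ_live < c·Λ` —
have mass `≤ ε`.  Anatomy on this event (what a proof may use, all landed): `Λ(S₀) ≳ log(1/δ)` on most of it
(stub 2), `Λ_live(S₀) = O(1)` on the part that matters (the conditional bad probability is `≤ e^{−Λ_live}`),
`κ_{S₀} ≤ 4δ/ε` (K1 `liveSeal_exposureBound`: the pocket is pressed against `b`'s off-pocket cluster along CLOSED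
pairs to live NON-relays of total weight `≳ log(ε/4δ)`), `|S₀| ≳ log(1/δ)/loglog(1/δ)` (`stub_smallPockets`),
and every `a` is `δ`-reliable while `μ_{G∖S₀}`-dead relays carry `(1−c)` of the weight.  As typed WITHOUT the bad
event (SketchR2I5 `LiveFractionConcentration`) the statement is false (4-vertex witness, Lines/SketchR2I5.md). -/
theorem stub_liveFractionRare :
    ∀ ε : ℝ, 0 < ε → ∀ c : ℝ, 0 < c → c < 1 → ∃ δ : ℝ, 0 < δ ∧
      ∀ (n : ℕ) (w : Sym2 (Fin n) → unitInterval) (A : Finset (Fin n)) (o b : Fin n), o ∉ A → o ≠ b →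
        (prodBernoulli w).real (⋃ a ∈ A, openConn o a)ᶜ ≤ δ →
        (∀ a ∈ A, (prodBernoulli w).real (openConn a b)ᶜ ≤ δ) →
        ∀ (P : Set (Sym2 (Fin n)) → Finset (Fin n)),
          (∀ ω v, v ∈ P ω ↔ ω ∈ openConnIn ((↑A : Set (Fin n))ᶜ) o v) →
          (prodBernoulli w).real {ω | ω ∉ openConn o b ∧ (∃ a ∈ A, ω ∈ openConn o a) ∧
              (∏ a ∈ A, ∏ x ∈ P ω, (1 - (w s(x, a) : ℝ))) ^ c <
                ∏ a ∈ A.filter (fun a => ω ∈ openConnIn ((↑(P ω) : Set (Fin n))ᶜ) a b),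
                  ∏ x ∈ P ω, (1 - (w s(x, a) : ℝ))} ≤ ε := by
  sorry

/-! ## The composition: stubs 1–4 give the crux BY NAME (real proofs from here on) -/

section Composition

variable {n : ℕ}

/-- `q`-products are nonnegative. -/
theorem prod_prod_nonneg (w : Sym2 (Fin n) → unitInterval) (B T : Finset (Fin n)) :
    0 ≤ ∏ a ∈ B, ∏ x ∈ T, (1 - (w s(x, a) : ℝ)) :=
  Finset.prod_nonneg fun a _ => Finset.prod_nonneg fun x _ => sub_nonneg.2 (w s(x, a)).2.2

/-- If `b` lies in the relay-free pocket then `o ↔ b`. -/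
theorem openConn_of_mem_openConnIn {A : Finset (Fin n)} {o b : Fin n} {ω : Set (Sym2 (Fin n))}
    (h : ω ∈ openConnIn ((↑A : Set (Fin n))ᶜ) o b) : ω ∈ openConn o b := by
  obtain ⟨ho, hb, hr⟩ := h
  exact hr.map (SimpleGraph.Embedding.induce _).toHom

/-- The pairs avoiding `T` contain all pairs inside `(↑T)ᶜ`. -/
theorem sym2_compl_subset_avoid (T : Finset (Fin n)) :
    ((↑T : Set (Fin n))ᶜ).sym2 ⊆ {e : Sym2 (Fin n) | ∀ x ∈ T, x ∉ e} := by
  intro e he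
  induction e using Sym2.ind with
  | _ u v =>
    intro x hxT hxe
    rw [Set.mk_mem_sym2_iff] at he
    rcases Sym2.mem_iff.1 hxe with rfl | rfl
    · exact he.1 (Finset.mem_coe.2 hxT)
    · exact he.2 (Finset.mem_coe.2 hxT)

/-- The live-relay set off `T` is determined by the pairs avoiding `T`. -/
theorem liveFilter_eq_of_inter_eq (A T : Finset (Fin n)) (b : Fin n) {ω ω' : Set (Sym2 (Fin n))}
    (h : ω ∩ {e : Sym2 (Fin n) | ∀ x ∈ T, x ∉ e} = ω' ∩ {e : Sym2 (Fin n) | ∀ x ∈ T, x ∉ e}) :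
    (A.filter fun a => ω ∈ openConnIn ((↑T : Set (Fin n))ᶜ) a b) =
      (A.filter fun a => ω' ∈ openConnIn ((↑T : Set (Fin n))ᶜ) a b) :=
  Finset.filter_congr fun a _ =>
    (determinedBy_iff _ _).1
      (DCT16.determinedBy_openConnIn ((↑T : Set (Fin n))ᶜ) a b (sym2_compl_subset_avoid T)) ω ω' h

/-- **The Jensen piece (`|A|`-free), from stubs 1–3.** For the relay-free pocket selector `P`, `o ∉ A` and
`0 < c ≤ 1`: `μ({o ↮ b} ∩ {liveProd ≤ allProd^c}) ≤ μ(o ↮ A)^c`. -/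
theorem bad_inter_liveLarge_le (w : Sym2 (Fin n) → unitInterval) (A : Finset (Fin n)) (o b : Fin n)
    (ho : o ∉ A) (P : Set (Sym2 (Fin n)) → Finset (Fin n))
    (hP : ∀ ω v, v ∈ P ω ↔ ω ∈ openConnIn ((↑A : Set (Fin n))ᶜ) o v)
    (c : ℝ) (hc0 : 0 < c) (hc1 : c ≤ 1) :
    (prodBernoulli w).real {ω | ω ∉ openConn o b ∧
        ∏ a ∈ A.filter (fun a => ω ∈ openConnIn ((↑(P ω) : Set (Fin n))ᶜ) a b),
            ∏ x ∈ P ω, (1 - (w s(x, a) : ℝ)) ≤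
          (∏ a ∈ A, ∏ x ∈ P ω, (1 - (w s(x, a) : ℝ))) ^ c} ≤
      ((prodBernoulli w).real (⋃ a ∈ A, openConn o a)ᶜ) ^ c := by
  -- notation (plain functions, so that everything unfolds by `rfl`)
  let μ := prodBernoulli w
  let allP : Finset (Fin n) → ℝ := fun T => ∏ a ∈ A, ∏ x ∈ T, (1 - (w s(x, a) : ℝ))
  let liveP : Finset (Fin n) → Set (Sym2 (Fin n)) → ℝ := fun T ω =>
    ∏ a ∈ A.filter (fun a => ω ∈ openConnIn ((↑T : Set (Fin n))ᶜ) a b), ∏ x ∈ T, (1 - (w s(x, a) : ℝ))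
  let E : Set (Set (Sym2 (Fin n))) := {ω | ω ∉ openConn o b ∧ liveP (P ω) ω ≤ (allP (P ω)) ^ c}
  let D : Finset (Fin n) → Set (Set (Sym2 (Fin n))) := fun T => {ω | liveP T ω ≤ (allP T) ^ c}
  change μ.real E ≤ (μ.real (⋃ a ∈ A, openConn o a)ᶜ) ^ c
  have hallP_nn : ∀ T, 0 ≤ allP T := fun T => prod_prod_nonneg w A T
  have hliveP_nn : ∀ T ω, 0 ≤ liveP T ω := fun T ω => prod_prod_nonneg w _ T
  -- each pocket piece is bounded through stub 1
  have hpiece : ∀ T : Finset (Fin n), μ.real (E ∩ {ω | P ω = T}) ≤ μ.real {ω | P ω = T} * (allP T) ^ c := by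
    intro T
    by_cases hbT : b ∈ T
    · -- `b` in the pocket forces `o ↔ b`: the piece is empty
      have hempty : E ∩ {ω | P ω = T} = ∅ := by
        ext ω
        simp only [Set.mem_inter_iff, Set.mem_setOf_eq, Set.mem_empty_iff_false, iff_false, not_and]
        intro hω hPT
        have hb : b ∈ P ω := hPT ▸ hbT
        exact hω.1 (openConn_of_mem_openConnIn ((hP ω b).1 hb))
      rw [hempty, measureReal_empty]
      exact mul_nonneg measureReal_nonneg (Real.rpow_nonneg (hallP_nn T) c)
    · have hD : DeterminedBy (D T) {e | ∀ x ∈ T, x ∉ e} := by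
        rw [determinedBy_iff]
        intro ω ω' h
        change (liveP T ω ≤ (allP T) ^ c) ↔ (liveP T ω' ≤ (allP T) ^ c)
        have hf := liveFilter_eq_of_inter_eq A T b h
        change (∏ a ∈ A.filter (fun a => ω ∈ openConnIn ((↑T : Set (Fin n))ᶜ) a b),
            ∏ x ∈ T, (1 - (w s(x, a) : ℝ))) ≤ (allP T) ^ c ↔
          (∏ a ∈ A.filter (fun a => ω' ∈ openConnIn ((↑T : Set (Fin n))ᶜ) a b),
            ∏ x ∈ T, (1 - (w s(x, a) : ℝ))) ≤ (allP T) ^ c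
        rw [hf]
      have h1 := stub_pocketLaplace n w A o b ho P hP T hbT (D T) hD
      have hsub : E ∩ {ω | P ω = T} ⊆ {ω | ω ∉ openConn o b ∧ P ω = T} ∩ D T := by
        rintro ω ⟨⟨hob, hle⟩, hPT⟩
        have hPT' : P ω = T := hPT
        refine ⟨⟨hob, hPT'⟩, ?_⟩
        change liveP T ω ≤ (allP T) ^ c
        rw [← hPT']
        exact hle
      have hint : ∫ ω in D T, liveP T ω ∂μ ≤ (allP T) ^ c := by
        have hmono : ∫ ω in D T, liveP T ω ∂μ ≤ ∫ ω in D T, (allP T) ^ c ∂μ :=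
          setIntegral_mono_on Integrable.of_finite.integrableOn Integrable.of_finite.integrableOn
            MeasurableSet.of_discrete fun ω hω => hω
        refine hmono.trans ?_
        rw [setIntegral_const, smul_eq_mul]
        calc μ.real (D T) * (allP T) ^ c ≤ 1 * (allP T) ^ c :=
              mul_le_mul_of_nonneg_right measureReal_le_one (Real.rpow_nonneg (hallP_nn T) c)
          _ = (allP T) ^ c := one_mul _
      calc μ.real (E ∩ {ω | P ω = T})
          ≤ μ.real ({ω | ω ∉ openConn o b ∧ P ω = T} ∩ D T) :=
            measureReal_mono hsub (measure_ne_top _ _)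
        _ ≤ μ.real {ω | P ω = T} * ∫ ω in D T, liveP T ω ∂μ := h1
        _ ≤ μ.real {ω | P ω = T} * (allP T) ^ c :=
            mul_le_mul_of_nonneg_left hint measureReal_nonneg
  -- partition over the pocket value
  have hcover : E ⊆ ⋃ T ∈ (Finset.univ : Finset (Finset (Fin n))), (E ∩ {ω | P ω = T}) := by
    intro ω hω
    simp only [Set.mem_iUnion, exists_prop]
    exact ⟨P ω, Finset.mem_univ _, hω, rfl⟩
  have hsum : μ.real E ≤ ∑ T : Finset (Fin n), μ.real (E ∩ {ω | P ω = T}) :=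
    (measureReal_mono hcover (measure_ne_top _ _)).trans (measureReal_biUnion_finset_le _ _)
  have hweights : ∑ T : Finset (Fin n), μ.real {ω | P ω = T} ≤ 1 := by
    have h := sum_measureReal_preimage_singleton (μ := μ) (f := P) (Finset.univ : Finset (Finset (Fin n)))
      (fun _ _ => MeasurableSet.of_discrete)
    rw [Finset.coe_univ, Set.preimage_univ, probReal_univ] at h
    calc ∑ T : Finset (Fin n), μ.real {ω | P ω = T}
        = ∑ T : Finset (Fin n), μ.real (P ⁻¹' {T}) := rfl
      _ ≤ 1 := h.le
  calc μ.real E ≤ ∑ T : Finset (Fin n), μ.real (E ∩ {ω | P ω = T}) := hsum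
    _ ≤ ∑ T : Finset (Fin n), μ.real {ω | P ω = T} * (allP T) ^ c :=
        Finset.sum_le_sum fun T _ => hpiece T
    _ ≤ (∑ T : Finset (Fin n), μ.real {ω | P ω = T} * allP T) ^ c :=
        stub_finiteJensen Finset.univ (fun T => μ.real {ω | P ω = T}) allP c hc0 hc1
          (fun T _ => measureReal_nonneg) hweights (fun T _ => hallP_nn T)
    _ ≤ (μ.real (⋃ a ∈ A, openConn o a)ᶜ) ^ c :=
        Real.rpow_le_rpow (Finset.sum_nonneg fun T _ => mul_nonneg measureReal_nonneg (hallP_nn T))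
          (stub_noAttachAll n w A o ho P hP) hc0.le

end Composition

/-- **`NearOneGluing` from the line `SketchR2I5` (finger–Laplace).**  Real proof: given `ε > 0`, take `δ₄` from
`stub_liveFractionRare` at `(ε/3, c = 1/2)` and `δ := min δ₄ (min ((ε/3)²) (ε/3))`; for an instance at level `δ`:
if `o = b` or `o ∈ A` the conclusion is trivial / a hypothesis; else
`μ(o ↮ b) ≤ μ(o ↮ A) + μ({o ↮ b} ∩ J) + μ(bad ∩ Jᶜ) < δ + δ^{1/2} + ε/3 ≤ ε` with `J = {liveProd ≤ allProd^{1/2}}`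
(`bad_inter_liveLarge_le` for the middle term, the residual for the last). -/
theorem NearOneGluing_of :
    Summit.CriticalPhenomena.PercolationContinuityZ3.Theses.PercNearOneGluing.NearOneGluing := by
  intro ε hε
  obtain ⟨δ₄, hδ₄, h4⟩ := stub_liveFractionRare (ε / 3) (by positivity) (1 / 2) (by norm_num) (by norm_num)
  refine ⟨min δ₄ (min ((ε / 3) ^ 2) (ε / 3)), lt_min hδ₄ (lt_min (by positivity) (by positivity)), ?_⟩
  intro n w A o b hoA hab
  set δ := min δ₄ (min ((ε / 3) ^ 2) (ε / 3)) with hδdef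
  have hδ₄' : δ ≤ δ₄ := min_le_left _ _
  have hδsq : δ ≤ (ε / 3) ^ 2 := (min_le_right _ _).trans (min_le_left _ _)
  have hδε : δ ≤ ε / 3 := (min_le_right _ _).trans (min_le_right _ _)
  let μ := prodBernoulli w
  change 1 - ε < μ.real (openConn o b)
  -- trivial cases
  by_cases hob : o = b
  · subst hob
    have : (openConn o o : Set (Set (Sym2 (Fin n)))) = Set.univ :=
      Set.eq_univ_of_forall fun ω => SimpleGraph.Reachable.refl _
    rw [this, probReal_univ]
    linarith
  by_cases ho : o ∈ A
  · have := hab o ho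
    change 1 - δ < μ.real (openConn o b) at this
    linarith
  -- complements
  have hcomplA : μ.real (⋃ a ∈ A, openConn o a)ᶜ < δ := by
    rw [probReal_compl_eq_one_sub MeasurableSet.of_discrete]
    change 1 - δ < μ.real (⋃ a ∈ A, openConn o a) at hoA
    linarith
  have hcomplab : ∀ a ∈ A, μ.real (openConn a b)ᶜ ≤ δ₄ := by
    intro a ha
    rw [probReal_compl_eq_one_sub MeasurableSet.of_discrete]
    have := hab a ha
    change 1 - δ < μ.real (openConn a b) at this
    linarith
  -- the pocket selector
  let P : Set (Sym2 (Fin n)) → Finset (Fin n) := fun ω =>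
    Finset.univ.filter fun v => ω ∈ openConnIn ((↑A : Set (Fin n))ᶜ) o v
  have hP : ∀ ω v, v ∈ P ω ↔ ω ∈ openConnIn ((↑A : Set (Fin n))ᶜ) o v := fun ω v => by
    simp [P]
  -- the three pieces
  let allP : Set (Sym2 (Fin n)) → ℝ := fun ω => ∏ a ∈ A, ∏ x ∈ P ω, (1 - (w s(x, a) : ℝ))
  let liveP : Set (Sym2 (Fin n)) → ℝ := fun ω =>
    ∏ a ∈ A.filter (fun a => ω ∈ openConnIn ((↑(P ω) : Set (Fin n))ᶜ) a b), ∏ x ∈ P ω, (1 - (w s(x, a) : ℝ))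
  let Bad : Set (Set (Sym2 (Fin n))) := (openConn o b)ᶜ
  let NoA : Set (Set (Sym2 (Fin n))) := (⋃ a ∈ A, openConn o a)ᶜ
  let J : Set (Set (Sym2 (Fin n))) := {ω | ω ∉ openConn o b ∧ liveP ω ≤ (allP ω) ^ (1 / 2 : ℝ)}
  let R : Set (Set (Sym2 (Fin n))) := {ω | ω ∉ openConn o b ∧ (∃ a ∈ A, ω ∈ openConn o a) ∧
      (allP ω) ^ (1 / 2 : ℝ) < liveP ω}
  have hcover : Bad ⊆ NoA ∪ (J ∪ R) := by
    intro ω hω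
    have hω' : ω ∉ openConn o b := hω
    by_cases hA : ω ∈ (⋃ a ∈ A, openConn o a)
    · right
      by_cases hle : liveP ω ≤ (allP ω) ^ (1 / 2 : ℝ)
      · left; exact ⟨hω', hle⟩
      · right
        refine ⟨hω', ?_, lt_of_not_ge hle⟩
        simpa only [Set.mem_iUnion, exists_prop] using hA
    · left; exact hA
  have hJ : μ.real J ≤ (μ.real NoA) ^ (1 / 2 : ℝ) :=
    bad_inter_liveLarge_le w A o b ho P hP (1 / 2) (by norm_num) (by norm_num)
  have hJ' : μ.real J ≤ ε / 3 := by
    refine hJ.trans ?_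
    have h1 : (μ.real NoA) ^ (1 / 2 : ℝ) ≤ ((ε / 3) ^ 2) ^ (1 / 2 : ℝ) :=
      Real.rpow_le_rpow measureReal_nonneg (hcomplA.le.trans hδsq) (by norm_num)
    have h2 : ((ε / 3) ^ 2) ^ (1 / 2 : ℝ) = ε / 3 := by
      rw [← Real.sqrt_eq_rpow, Real.sqrt_sq (by positivity)]
    linarith
  have hR : μ.real R ≤ ε / 3 :=
    h4 n w A o b ho hob (hcomplA.le.trans hδ₄') hcomplab P hP
  have hBad : μ.real Bad < ε := by
    calc μ.real Bad ≤ μ.real (NoA ∪ (J ∪ R)) := measureReal_mono hcover (measure_ne_top _ _)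
      _ ≤ μ.real NoA + μ.real (J ∪ R) := measureReal_union_le _ _
      _ ≤ μ.real NoA + (μ.real J + μ.real R) := by
          have := measureReal_union_le (μ := μ) J R
          linarith
      _ < δ + (ε / 3 + ε / 3) := by linarith
      _ ≤ ε := by linarith
  have hfin : μ.real (openConn o b) = 1 - μ.real Bad := by
    have := probReal_compl_eq_one_sub (μ := μ) (s := openConn o b) MeasurableSet.of_discrete
    change μ.real Bad = 1 - μ.real (openConn o b) at this
    linarith
  rw [hfin]
  linarith


/-! ## Cycle 3 (lead c3, 2026-08-16): registered anatomy stubs + the LRF (least-reliable-first) route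

Two deterministic anatomy lemmas (crossing seals) and three stubs around the lead's new finding, the
LEAST-RELIABLE-FIRST hitting rule (Cruxes/NearOneGluing/Ideas/lrf-hitting-rule.md): with `u(v) := μ(v ↮ b)` and
`a*` := the relay reached from `o` through the "most unreliable terrain" (maximin of `u` over open paths, ties by
index — displayed below through the level-set events `reach θ x := {o ↔ x inside {v | θ ≤ u v} ∪ {o}}`), the inequality
`μ(o ↔ A, o ↮ b) ≤ Σ_a μ(a* = a) · u(a)` (stub `stub_lrfGluing`, conjectural: 0 violations in > 10⁵ exact instances, every
other probing order fails) implies KN Conjecture 1 and hence the crux (`stub_lrfGlue`, provable; composition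
`NearOneGluing_of_lrf`).  `stub_lrfDepthOneTwo` is its first proved instance beyond Harris (depth one, two relays).
STATUS at the end of cycle 3: LANDED — stub_crossingSeals + stub_crossingSealsIsolation (p118053), stub_lrfGlue (p118081),
stub_lrfDepthOneTwo (p118468), stub_hubPiece (p118674), stub_orderingBound (p119041), stub_pivotalityDomination (p119643),
stub_lrfDepthOneSeq (p120001), stub_lrfDepthOneStatic (p120833); OPEN — stub_lrfGluing (conjecture) and stub_liveFractionRare (≡ crux) only.
Cycle 4 (lead c4, continuation): the three stubs landed late in cycle 3 are now imported by name (no placeholder `sorry` left);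
the file's only sorries are the two honest ones (`stub_liveFractionRare` ≡ crux, `stub_lrfGluing` = the LRF conjecture). -/

/-- STUB (size S–M; lead c3; sources: cut submodularity/posimodularity, e.g. Schrijver, Combinatorial Optimization §44.1;
`prodBernoulli_real_forall_notMem`-type product formulas in Literature.Probability.LatticeModels.ProdBernoulliIndependence).
**Crossing seals (posimodularity of closed-boundary probabilities).**  For vertex sets `S, T` the events
"every pair from `X` to `Xᶜ` is closed" satisfy `μ(seal S) · μ(seal T) ≤ μ(seal (S ∖ T)) · μ(seal (T ∖ S))`.
Proof route: `μ(seal X) = ∏_{x ∈ X} ∏_{y ∉ X} (1 − w s(x,y))`; after cancelling the common factors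
`∏_{S∖T × Sᶜ}` and `∏_{T∖S × Tᶜ}` the claim is `∏_{x∈S∩T}(∏_{y∉S} f ∏_{y∉T} f) ≤ ∏_{y∈S∩T} ∏_{x∈S△T} f(x,y)`,
`f = 1 − w ≤ 1`, which holds because `T∖S ⊆ Sᶜ`, `S∖T ⊆ Tᶜ` (dropping factors `≤ 1` increases a product) and `f` is
symmetric. -/
theorem stub_crossingSeals :
    ∀ (n : ℕ) (w : Sym2 (Fin n) → unitInterval) (S T : Finset (Fin n)),
      (prodBernoulli w).real {ω | ∀ x ∈ S, ∀ y ∉ S, s(x, y) ∉ ω} *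
          (prodBernoulli w).real {ω | ∀ x ∈ T, ∀ y ∉ T, s(x, y) ∉ ω} ≤
        (prodBernoulli w).real {ω | ∀ x ∈ S \ T, ∀ y ∉ S \ T, s(x, y) ∉ ω} *
          (prodBernoulli w).real {ω | ∀ x ∈ T \ S, ∀ y ∉ T \ S, s(x, y) ∉ ω} :=
  Summit.CriticalPhenomena.PercolationContinuityZ3.Theorems.stub_crossingSeals

/-- STUB (size S; lead c3; from `stub_crossingSeals`).  **Crossing seals pay relay isolation.**  If `a ∈ S ∖ T` and
`a' ∈ T ∖ S` then `μ(seal S) · μ(seal T) ≤ μ(C(a) ⊆ S ∖ T) · μ(C(a') ⊆ T ∖ S)`: on `seal (S ∖ T)` no open path leaves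
`S ∖ T`, so `a` reaches no vertex outside it (in particular neither `o ∈ S ∩ T` nor `b ∉ S ∪ T` in the crux reading:
two crossing bad-cluster seals cost at least the product of two relay-isolation probabilities). -/
theorem stub_crossingSealsIsolation :
    ∀ (n : ℕ) (w : Sym2 (Fin n) → unitInterval) (S T : Finset (Fin n)) (a a' : Fin n),
      a ∈ S \ T → a' ∈ T \ S →
      (prodBernoulli w).real {ω | ∀ x ∈ S, ∀ y ∉ S, s(x, y) ∉ ω} *
          (prodBernoulli w).real {ω | ∀ x ∈ T, ∀ y ∉ T, s(x, y) ∉ ω} ≤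
        (prodBernoulli w).real {ω | ∀ z ∉ S \ T, ω ∉ openConn a z} *
          (prodBernoulli w).real {ω | ∀ z ∉ T \ S, ω ∉ openConn a' z} :=
  Summit.CriticalPhenomena.PercolationContinuityZ3.Theorems.stub_crossingSealsIsolation

/- `stub_lrfDepthOneTwo` — LANDED p118468 as `Summit.CriticalPhenomena.PercolationContinuityZ3.Theorems.stub_lrfDepthOneTwo`
   (Theorems/PercNearOneGluingNearOneGluingLrfDepthOneTwo.lean); statement removed from the skeleton (not used by the compositions). -/

/- `stub_lrfGlue` — LANDED p118081 (Theorems/PercNearOneGluingNearOneGluingLrfGlue.lean: the LRF hitting inequality ⟹ NearOneGluing);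
   statement removed from the skeleton by lead c4 together with the retired conjecture `stub_lrfGluing` (its hypothesis). -/

/- `stub_lrfGluing` (the LRF / maximin-index hitting conjecture of lead c3) and its composition `NearOneGluing_of_lrf`
   were RETIRED from the skeleton by lead c4 (cycle 4): the conjecture is superseded by the weaker, process-free
   `stub_maxattGluing` below (LRF ⟹ MAXATT, both imply KN Conjecture 1 and the crux); `stub_lrfGlue` above stays landed. -/

/- `stub_hubPiece` — LANDED p118674 (Theorems/PercNearOneGluingNearOneGluingHubPiece.lean); statement removed from the skeleton. -/


/- `stub_orderingBound` — LANDED p119041 (Theorems/PercNearOneGluingNearOneGluingOrderingBound.lean); statement removed from the skeleton. -/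


/-- STUB (size M; lead c3; source: the landed `knLemma3i` (Theorems/PercNearOneGluingNearOneGluingKnLemma3i.lean, p73538 =
KN arXiv:2401.12397 Lemma 3(i), BHK-based) with `d = 0` and `Q = openConn a₂ o`).  **Pivotality domination** (new; exact-checked
on 480 random graphs): if `a₁` is at most as reliable as `a₂` (`μ(a₁ ↔ b) ≤ μ(a₂ ↔ b)`), then the pair `e₁ = s(o, a₁)` — `a₁`'s own
edge to an arbitrary vertex `o` — is at least as pivotal for `a₁ ↔ b` as for `a₂ ↔ b`:
`μ{e₁ closed-pivotal for a₂ ↔ b} ≤ μ{e₁ closed-pivotal for a₁ ↔ b}` ("your own edge helps you at least as much as anyone more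
reliable than you").  Proof route: `{ω ∉ a₂↔b, insert e₁ ω ∈ a₂↔b} ⊆ ({a₂↮b} ∩ {a₂↔o} ∩ {a₁↔b}) ∪ ({a₂↮b} ∩ {a₂↔a₁} ∩ {o↔b})`
(a new open path must use `e₁`); `μ({a₁↔b} ∩ {a₂↔o}) ≤ μ({a₂↔b} ∩ {a₂↔o})` by `knLemma3i` (Q increasing in the edge cluster of
`a₂`), so the first piece is `≤ μ({a₂↔b} ∩ {a₂↔o} ∩ {a₁↮b})` after removing the common part `{a₁↔b↔a₂↔o}`; the second piece lies in
`{a₁↮b} ∩ {o↔b} ∩ {a₂↔a₁}`; the two bounds are disjoint (`a₂ ↔ b` vs `a₂ ↮ b`) and both inside `{a₁ ↮ b} ∩ {o ↔ b}` =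
`{ω ∉ a₁↔b, insert e₁ ω ∈ a₁↔b}` (note both displayed events force `e₁ ∉ ω`). -/
theorem stub_pivotalityDomination :
    ∀ (n : ℕ) (w : Sym2 (Fin n) → unitInterval) (o a₁ a₂ b : Fin n),
      (prodBernoulli w).real (openConn a₁ b) ≤ (prodBernoulli w).real (openConn a₂ b) →
      (prodBernoulli w).real {ω | ω ∉ openConn a₂ b ∧ insert s(o, a₁) ω ∈ openConn a₂ b} ≤
        (prodBernoulli w).real {ω | ω ∉ openConn a₁ b ∧ insert s(o, a₁) ω ∈ openConn a₁ b} :=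
  Summit.CriticalPhenomena.PercolationContinuityZ3.Theorems.stub_pivotalityDomination

/-- STUB (size L; lead c3; sources: `stub_pivotalityDomination`, the landed one-bond decomposition `stub_oneBondDecomp_k15`
(Theorems/PercNearOneGluingAdditiveGluingOneBond.lean: `μ_w(S) = (1 − w e)·μ_{w[e↦0]}(S) + (w e)·μ_{w[e↦1]}(S)`, with
`goodStepEI_real_inter_closed_eq` / `_open_eq`), `prodBernoulli_ae_forall_notMem` for weight-0 pairs).
**Least-reliable-first at depth one, SEQUENTIAL form, all `|A|` (theorem — the depth-one case of the LRF programme).**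
Let every positive-weight neighbour of `o` be among the attached relays `a 0, …, a (k−1)` (injective, `≠ o`), ordered
SEQUENTIALLY: `a j` is the least reliable among `a j, …, a (k−1)` in the graph `w_j` obtained by zeroing the pairs
`s(o, a l)`, `l < j` (i.e. conditionally on the earlier probes being closed — the adaptive rule, which at depth one has only
relay-absorbing steps).  Then with `p_i = w s(o, a i)`:
`μ(o ↮ b, ∃ i, o ↔ a i) ≤ Σ_i p_i ∏_{l<i} (1 − p_l) · μ(a i ↮ b)`  (`= Σ_a μ(a* = a)·u(a)` for this rule).
Proof route: induction on `k` (family `a ∘ Fin.succ`, weights `w' = w[e₀ ↦ 0]`, `e₀ = s(o, a 0)`; `w'_j = w_{j+1}` and the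
depth-one hypothesis passes to `w'`).  With `μ± = prodBernoulli (w[e₀ ↦ 1/0])`, `D_i = (a i ↮ b)`, `p = p₀`:
`μ(bad) = (1−p) μ⁻(bad) + p μ⁺(bad)`, `μ⁺(bad) = μ⁺(D₀)` (under `μ⁺`, `e₀` is a.s. open), `μ⁻(bad) = μ⁻(bad')` a.s. (an open path from
`o` starts with a positive-weight star pair, which under `μ⁻` is some `s(o, a i)`, `i ≥ 1`), IH on `(w', a ∘ succ)`:
`μ⁻(bad') ≤ Σ_{i≥1} π'_i μ⁻(D_i)`; target `Σ_i π_i μ(D_i)` with `π_0 = p`, `π_i = (1−p)π'_i`, `μ(D_i) = (1−p)μ⁻(D_i) + pμ⁺(D_i)`;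
TARGET − BOUND `= p(1−p)[Piv₀ − Σ_{i≥1} π'_i Piv_i]`, `Piv_i := μ⁻(D_i) − μ⁺(D_i) ≥ 0`, and
`(1−p)·Piv_i = μ{ω ∉ (a i)↔b, insert e₀ ω ∈ (a i)↔b} ≤ μ{ω ∉ (a 0)↔b, insert e₀ ω ∈ (a 0)↔b} = (1−p)·Piv₀` by
`stub_pivotalityDomination` (admissibility at `j = 0`), while `Σ_{i≥1} π'_i = 1 − ∏_{i≥1}(1−p_i) ≤ 1`; if `p = 1` the factor `p(1−p)`
vanishes.  Exact-checked: 400 random depth-one instances, |A| ≤ 5, 0 violations (lab/gammaH_check.py, §Log 21:05Z). -/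
theorem stub_lrfDepthOneSeq :
    ∀ (n k : ℕ) (w : Sym2 (Fin n) → unitInterval) (o b : Fin n) (a : Fin k → Fin n),
      Function.Injective a → (∀ i, a i ≠ o) →
      (∀ x : Fin n, x ≠ o → w s(o, x) ≠ 0 → ∃ i, a i = x) →
      (∀ j i : Fin k, j < i →
        (prodBernoulli (fun e => if ∃ l : Fin k, l < j ∧ e = s(o, a l) then 0 else w e)).real
            (openConn (a j) b) ≤
          (prodBernoulli (fun e => if ∃ l : Fin k, l < j ∧ e = s(o, a l) then 0 else w e)).real
            (openConn (a i) b)) →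
      (prodBernoulli w).real {ω | ω ∉ openConn o b ∧ ∃ i, ω ∈ openConn o (a i)} ≤
        ∑ i : Fin k, (w s(o, a i) : ℝ) * (∏ l ∈ Finset.univ.filter (fun l : Fin k => l < i), (1 - (w s(o, a l) : ℝ))) *
          (prodBernoulli w).real (openConn (a i) b)ᶜ :=
  Summit.CriticalPhenomena.PercolationContinuityZ3.Theorems.stub_lrfDepthOneSeq


/-- STUB (size M; lead c3; from `stub_lrfDepthOneSeq` + a rearrangement inequality).  **Least-reliable-first at depth one, STATIC order, all
`|A|`** — the depth-one case of the registered conjecture `stub_lrfGluing` (MMI = static u-order among the attached relays at depth one).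
Same setting as `stub_lrfDepthOneSeq`, but the attached relays are simply sorted by unreliability in `w` itself:
`μ(a j ↔ b) ≤ μ(a i ↔ b)` for `j < i`.  Proof route: (1) the functional `F(σ) := Σ_i p_{σ i} ∏_{l<i}(1 − p_{σ l}) · u_{σ i}`
(`p_x = w s(o,x)`, `u_x = μ(x ↮ b)`) satisfies the ADJACENT EXCHANGE identity `F(σ ∘ swap(i,i+1)) − F(σ) = C·p_x p_y (u_y − u_x)`
(`x = σ i`, `y = σ (i+1)`, `C = ∏_{l<i}(1−p_{σ l}) ≥ 0`), hence `F` is MAXIMAL at any `u`-non-increasing order (bubble sort / `List.Perm`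
induction, or `Finset` induction on inversions); (2) construct a sequential order `σ` (greedily: `σ 0` minimises `μ_w(a i ↔ b)`, then recurse
on `w[s(o, a (σ 0)) ↦ 0]`) and apply `stub_lrfDepthOneSeq` to the family `a ∘ σ` (its hypotheses are permutation-invariant except
admissibility, which holds by construction) to get `bad ≤ F(σ)`; (3) `F(σ) ≤ F(id)` by (1) since `id` is `u`-non-increasing; the
left side does not depend on the order (`∃ i, o ↔ a i` is permutation-invariant). -/
theorem stub_lrfDepthOneStatic :
    ∀ (n k : ℕ) (w : Sym2 (Fin n) → unitInterval) (o b : Fin n) (a : Fin k → Fin n),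
      Function.Injective a → (∀ i, a i ≠ o) →
      (∀ x : Fin n, x ≠ o → w s(o, x) ≠ 0 → ∃ i, a i = x) →
      (∀ j i : Fin k, j < i →
        (prodBernoulli w).real (openConn (a j) b) ≤ (prodBernoulli w).real (openConn (a i) b)) →
      (prodBernoulli w).real {ω | ω ∉ openConn o b ∧ ∃ i, ω ∈ openConn o (a i)} ≤
        ∑ i : Fin k, (w s(o, a i) : ℝ) * (∏ l ∈ Finset.univ.filter (fun l : Fin k => l < i), (1 - (w s(o, a l) : ℝ))) *
          (prodBernoulli w).real (openConn (a i) b)ᶜ :=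
  Summit.CriticalPhenomena.PercolationContinuityZ3.Theorems.stub_lrfDepthOneStatic


/-! ## Cycle 4 (lead c4, 2026-08-16): the MAXATT route — "bad mass ≤ expected unreliability of the
least reliable ATTACHED relay" — and the generalized Lemma 3 (GL3)

Notation (displayed, no definitions).  `μ = prodBernoulli w`, target `b`, source `o ∉ A`, relay set `A ∋ b`
(adjoining `b` is free for the crux), `u(v) := μ(v ↮ b)`.  The RELAY-FREE POCKET of `o` is its open cluster inside
`(↑A)ᶜ`; the relay `a` is ATTACHED iff `ω ∈ openConnIn (insert a (↑A)ᶜ) o a` (an open `o–a` path whose interior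
avoids `A`).  The SELECTED relay is the attached one with the largest `u` (ties: largest index).
* `stub_maxattGluing` (CONJECTURE "MAXATT"): `μ(o ↮ b, some relay attached) ≤ Σ_a u(a)·μ(a selected)`
  = `E[max_{attached} u]`.  It is implied by lead c3's LRF conjecture (the first relay absorbed by the
  least-reliable-first exploration is attached, so `u(a*) ≤ max_{attached} u`) and coincides with it (and with the
  bottleneck form S2) for saturated relay sets; it implies KN Conjecture 1 (`max ≤ max_A u`, `Σ_a μ(a selected) ≤ μ(o ↔ A)`),
  hence AdditiveGluing (stmt-4576) and the crux with linear rate.  Exact enumeration (lab/satlrf.c, test3–5.c, gl3.c of lead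
  c4): 0 violations (all prefixes of the u-order on > 10⁴ weighted graphs n ≤ 9, |A| ≤ 6, plus hill-climbs).
* `stub_maxattGlue` (provable, M): MAXATT ⟹ `NearOneGluing` (δ = ε/3; cf. `stub_lrfGlue`).
* `stub_maxattTwo` (PROVED by lead c4, work/stubs/MaxattTwo.lean, rc 0): the two-relay case at ARBITRARY depth —
  `μ(o ↮ b, X ∪ Y) ≤ u(y) μ(Y) + u(x) μ(X ∖ Y)` for `u(x) ≤ u(y)` — from Harris + Kozma–Nitzan Lemma 3(i) (`knLemma3i`).
  (Lead c3's `stub_lrfDepthOneTwo` is its depth-one case.)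
* `stub_gl3` (CONJECTURE "GL3", generalized KN Lemma 3(i)): for an outsider `x` at least as reliable as every member of a
  family `A` (`b, x ∉ A`; pockets avoid `A ∪ {x, b}`), the attachment event `F` of the family boosts `x` no more than the
  family's own MAXATT-slack on `F`:  `μ(x ↔ b, F) − μ(x ↔ b) μ(F) ≤ μ(o ↔ b, F) − Σ_{a∈A} μ(a ↔ b) μ(a selected on F)`.
  For a one-member family this IS KN Lemma 3(i) (landed `knLemma3i`); 0 violations in > 5·10³ exact instances, |A| ≤ 4,
  incl. hill-climbs (lab/gl3.c).  Every TERMWISE split of GL3 into Lemma-3(i) instances is false (lab/test3–5.c: the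
  "E-form", "PEEL" and "IND" variants all have exact counterexamples) — the inequality is globally balanced.
* `stub_maxattOfGl3` (provable, M): GL3 ⟹ MAXATT (take `x` = the lexicographically most reliable relay of `A ∖ {b}`;
  Harris for `{x ↔ b}` on `Att x ∪ F`, then GL3; the two-relay proof is the template).
Compositions: `NearOneGluing_of_maxatt`, `NearOneGluing_of_gl3` (real proofs, modulo the stubs). -/

/-- STUB (lead c4; CONJECTURAL — "MAXATT").  For `o ∉ A ∋ b`:
`μ{o ↮ b ∧ ∃ a ∈ A attached} ≤ Σ_{a ∈ A} μ(a ↮ b) · μ{a attached ∧ every attached a' has (u a', a') ≤ₗₑₓ (u a, a)}`,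
`attached a := openConnIn (insert a (↑A)ᶜ) o a`, `u v := μ(v ↮ b)`.  Implied by LRF (lead c3), implies KN Conjecture 1.
Evidence: Lines/SketchR2I5.md §cycle 4; 0 violations in exact enumeration. -/
theorem stub_maxattGluing :
    ∀ (n : ℕ) (w : Sym2 (Fin n) → unitInterval) (A : Finset (Fin n)) (o b : Fin n), o ∉ A → b ∈ A →
      (prodBernoulli w).real {ω | ω ∉ openConn o b ∧
          ∃ a ∈ A, ω ∈ openConnIn (insert a ((↑A : Set (Fin n))ᶜ)) o a} ≤
        ∑ a ∈ A, (prodBernoulli w).real (openConn a b)ᶜ *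
          (prodBernoulli w).real {ω | ω ∈ openConnIn (insert a ((↑A : Set (Fin n))ᶜ)) o a ∧
            ∀ a' ∈ A, ω ∈ openConnIn (insert a' ((↑A : Set (Fin n))ᶜ)) o a' →
              ((prodBernoulli w).real (openConn a' b)ᶜ < (prodBernoulli w).real (openConn a b)ᶜ ∨
                ((prodBernoulli w).real (openConn a' b)ᶜ = (prodBernoulli w).real (openConn a b)ᶜ ∧ a' ≤ a))} := by
  sorry

/-- STUB (lead c4; size M; sources: the union-bound glue of `stub_lrfGlue` / Disproof.lean §3–§4; the "first relay on an
open `o–a` path is attached" walk argument of `exposureDecomp_exists_attached`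
(Theorems/PercNearOneGluingNearOneGluingExposureDecomp.lean) or of `stub_lrfGlue`'s proof
(Theorems/PercNearOneGluingNearOneGluingLrfGlue.lean); `measureReal_biUnion_finset_le`, `probReal_compl_eq_one_sub`).
**MAXATT implies the crux.**  The hypothesis is `stub_maxattGluing` verbatim; the conclusion is `NearOneGluing` unfolded (`δ = ε/3`).
Proof route: given `ε`, take `δ = ε/3`; for an instance at level `δ` with `o ≠ b`, `o ∉ A` (else trivial) apply the
hypothesis to `A' := insert b A` (`o ∉ A'`, `b ∈ A'`): (i) `{o ↮ b} ⊆ {o ↮ b ∧ ∃ a ∈ A', attached'} ∪ {∀ a ∈ A', ¬attached'}`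
and `{∀ a ∈ A', ¬ attached'} ⊆ (⋃ a ∈ A, openConn o a)ᶜ` (an open `o–a` path meets `A'` first at some `a''`, its initial
segment attaches `a''`), so the second event has mass `< δ`; (ii) the selected-relay events are pairwise disjoint in `a`,
each factor `μ(a ↮ b) < δ` for `a ∈ A` and `= 0` for `a = b` (`openConn b b = univ`), so the sum is `≤ δ · 1`;
total `μ(o ↮ b) < 2δ < ε`. -/
theorem stub_maxattGlue :
    (∀ (n : ℕ) (w : Sym2 (Fin n) → unitInterval) (A : Finset (Fin n)) (o b : Fin n), o ∉ A → b ∈ A →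
      (prodBernoulli w).real {ω | ω ∉ openConn o b ∧
          ∃ a ∈ A, ω ∈ openConnIn (insert a ((↑A : Set (Fin n))ᶜ)) o a} ≤
        ∑ a ∈ A, (prodBernoulli w).real (openConn a b)ᶜ *
          (prodBernoulli w).real {ω | ω ∈ openConnIn (insert a ((↑A : Set (Fin n))ᶜ)) o a ∧
            ∀ a' ∈ A, ω ∈ openConnIn (insert a' ((↑A : Set (Fin n))ᶜ)) o a' →
              ((prodBernoulli w).real (openConn a' b)ᶜ < (prodBernoulli w).real (openConn a b)ᶜ ∨
                ((prodBernoulli w).real (openConn a' b)ᶜ = (prodBernoulli w).real (openConn a b)ᶜ ∧ a' ≤ a))}) →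
    ∀ ε : ℝ, 0 < ε → ∃ δ : ℝ, 0 < δ ∧ ∀ (n : ℕ) (w : Sym2 (Fin n) → unitInterval) (A : Finset (Fin n)) (o b : Fin n),
      1 - δ < (prodBernoulli w).real (⋃ a ∈ A, openConn o a) →
      (∀ a ∈ A, 1 - δ < (prodBernoulli w).real (openConn a b)) → 1 - ε < (prodBernoulli w).real (openConn o b) :=
  Summit.CriticalPhenomena.PercolationContinuityZ3.Theorems.stub_maxattGlue

/-- STUB (lead c4; PROVED in work/stubs/MaxattTwo.lean — kept as `sorry` here only until the helper file has landed and its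
module is built; sources: `prodBernoulli_harris`, `knLemma3i`, `isUpperSet_openConn`).  **MAXATT for two relays at
arbitrary depth.**  With `X = {o ↔ x inside {v ≠ b, v ≠ y}}`, `Y = {o ↔ y inside {v ≠ b, v ≠ x}}` and `μ(y ↔ b) ≤ μ(x ↔ b)`:
`μ(o ↮ b, X ∪ Y) ≤ μ(y ↮ b) μ(Y) + μ(x ↮ b) μ(X ∖ Y)`.  Proof: on `X`, `o ↔ b ⟺ x ↔ b`; on `Y`, `o ↔ b ⟺ y ↔ b`; Harris for
`{x ↔ b}` and `X ∪ Y`; KN Lemma 3(i) with `Q = Y` (increasing in the open edge cluster of `y`):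
`μ(x ↔ b, Y) ≤ μ(y ↔ b, Y) + (μ(x↔b) − μ(y↔b)) μ(Y)`; linear bookkeeping. -/
theorem stub_maxattTwo :
    ∀ (n : ℕ) (w : Sym2 (Fin n) → unitInterval) (o b x y : Fin n),
      (prodBernoulli w).real (openConn y b) ≤ (prodBernoulli w).real (openConn x b) →
      (prodBernoulli w).real {ω | ω ∉ openConn o b ∧
          (ω ∈ openConnIn {v : Fin n | v ≠ b ∧ v ≠ y} o x ∨ ω ∈ openConnIn {v : Fin n | v ≠ b ∧ v ≠ x} o y)} ≤
        (prodBernoulli w).real (openConn y b)ᶜ *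
            (prodBernoulli w).real (openConnIn {v : Fin n | v ≠ b ∧ v ≠ x} o y) +
          (prodBernoulli w).real (openConn x b)ᶜ *
            (prodBernoulli w).real
              (openConnIn {v : Fin n | v ≠ b ∧ v ≠ y} o x \ openConnIn {v : Fin n | v ≠ b ∧ v ≠ x} o y) :=
  Summit.CriticalPhenomena.PercolationContinuityZ3.Theorems.stub_maxattTwo

/-- STUB (lead c4; CONJECTURAL — "GL3", the generalized Kozma–Nitzan Lemma 3(i)).  Family `A` with `o, b, x ∉ A`, outsider
`x` at least as reliable as every member (`μ(a ↔ b) ≤ μ(x ↔ b)`); pockets avoid `B := insert x (insert b A)`: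
`attached a := openConnIn (insert a (↑B)ᶜ) o a`, `F := {∃ a ∈ A, attached a}`, selection on `F` as in MAXATT (largest
`u`, ties by largest index, among the attached members of `A`).  CLAIM:
`μ(x ↔ b, F) − μ(x ↔ b)·μ(F) ≤ μ(o ↔ b, F) − Σ_{a ∈ A} μ(a ↔ b)·μ(a selected)`.
One-member family = KN Lemma 3(i) (`knLemma3i`, landed).  Evidence: 0 violations, |A| ≤ 4, > 5·10³ exact instances +
hill-climbs (lab/gl3.c); all termwise reductions to Lemma 3(i) are false (lab/test3–5.c). -/
theorem stub_gl3 :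
    ∀ (n : ℕ) (w : Sym2 (Fin n) → unitInterval) (A : Finset (Fin n)) (o b x : Fin n), o ∉ A → b ∉ A → x ∉ A →
      (∀ a ∈ A, (prodBernoulli w).real (openConn a b) ≤ (prodBernoulli w).real (openConn x b)) →
      (prodBernoulli w).real (openConn x b ∩
          {ω | ∃ a ∈ A, ω ∈ openConnIn (insert a ((↑(insert x (insert b A)) : Set (Fin n))ᶜ)) o a}) -
        (prodBernoulli w).real (openConn x b) *
          (prodBernoulli w).real {ω | ∃ a ∈ A, ω ∈ openConnIn (insert a ((↑(insert x (insert b A)) : Set (Fin n))ᶜ)) o a} ≤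
      (prodBernoulli w).real (openConn o b ∩
          {ω | ∃ a ∈ A, ω ∈ openConnIn (insert a ((↑(insert x (insert b A)) : Set (Fin n))ᶜ)) o a}) -
        ∑ a ∈ A, (prodBernoulli w).real (openConn a b) *
          (prodBernoulli w).real {ω | ω ∈ openConnIn (insert a ((↑(insert x (insert b A)) : Set (Fin n))ᶜ)) o a ∧
            ∀ a' ∈ A, ω ∈ openConnIn (insert a' ((↑(insert x (insert b A)) : Set (Fin n))ᶜ)) o a' →
              ((prodBernoulli w).real (openConn a' b)ᶜ < (prodBernoulli w).real (openConn a b)ᶜ ∨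
                ((prodBernoulli w).real (openConn a' b)ᶜ = (prodBernoulli w).real (openConn a b)ᶜ ∧ a' ≤ a))} := by
  sorry

/-- STUB (lead c4; size M–L; sources: the proof of `stub_maxattTwo` (work/stubs/MaxattTwo.lean, template), `prodBernoulli_harris`,
`isUpperSet_openConn`, `isUpperSet_openConnIn`, `Finset.sum_erase`, `Finset.exists_min_image` for the lex-minimum).
**GL3 implies MAXATT.**  Hypothesis = `stub_gl3` verbatim, conclusion = `stub_maxattGluing` verbatim.
Proof route, for `o ∉ A ∋ b`: put `A₀ := A.erase b`.  If `A₀ = ∅` the left side vanishes (`b` attached forces `o ↔ b`,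
since `openConnIn _ o b ⊆ openConn o b`).  Otherwise let `x ∈ A₀` be the lexicographic minimum of `a ↦ (μ(a ↮ b), a)` on `A₀`
(so `μ(a ↔ b) ≤ μ(x ↔ b)` on `A' := A₀.erase x`, and `x` is never selected when some `a' ∈ A'` is attached), and note
`insert x (insert b A') = A`, so GL3's pockets/attachments for the family `A'` are exactly MAXATT's for `A`; write
`X := attached x`, `F := {∃ a ∈ A', attached a}`.  Then (as in `stub_maxattTwo`): `μ(o ↮ b, ∃ a ∈ A attached)
= μ(o ↮ b, X ∪ F)` (attached `b` forces `o ↔ b`); `μ(o ↔ b, X ∪ F) = μ(x ↔ b, X ∖ F) + μ(o ↔ b, F)` (on `X`, `o ↔ x`);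
`= μ(x ↔ b, X ∪ F) − μ(x ↔ b, F) + μ(o ↔ b, F) ≥ μ(x↔b) μ(X ∪ F) − μ(x↔b) μ(F) + Σ_{a∈A'} μ(a↔b) μ(a selected on F)`
(Harris, then GL3); hence `bad ≤ μ(x ↮ b) μ(X ∖ F) + Σ_{a ∈ A'} μ(a ↮ b) μ(a selected on F)` using
`μ(F) = Σ_{a∈A'} μ(a selected on F)` (the selection events partition `F`); finally identify with MAXATT's right side:
the `b`-term vanishes (`μ(b ↮ b) = 0`), the `x`-term is `μ(x ↮ b)·μ(X ∖ F')` where being selected in `A` for `x` means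
attached and no `a' ∈ A'` with `u a' > 0`… — terms with `μ(a ↮ b) = 0` vanish on both sides, and for `μ(a ↮ b) > 0`,
"selected in `A`" coincides with "selected on `F`" (`b` and `x` never beat such an `a`; `x` is beaten by every attached
`a' ∈ A'`), while `{x selected in A} ⊇ X ∖ F` up to the same null terms (prove `≤` by monotonicity: MAXATT's right side
is ≥ the displayed bound). -/
theorem stub_maxattOfGl3 :
    (∀ (n : ℕ) (w : Sym2 (Fin n) → unitInterval) (A : Finset (Fin n)) (o b x : Fin n), o ∉ A → b ∉ A → x ∉ A →
      (∀ a ∈ A, (prodBernoulli w).real (openConn a b) ≤ (prodBernoulli w).real (openConn x b)) →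
      (prodBernoulli w).real (openConn x b ∩
          {ω | ∃ a ∈ A, ω ∈ openConnIn (insert a ((↑(insert x (insert b A)) : Set (Fin n))ᶜ)) o a}) -
        (prodBernoulli w).real (openConn x b) *
          (prodBernoulli w).real {ω | ∃ a ∈ A, ω ∈ openConnIn (insert a ((↑(insert x (insert b A)) : Set (Fin n))ᶜ)) o a} ≤
      (prodBernoulli w).real (openConn o b ∩
          {ω | ∃ a ∈ A, ω ∈ openConnIn (insert a ((↑(insert x (insert b A)) : Set (Fin n))ᶜ)) o a}) -
        ∑ a ∈ A, (prodBernoulli w).real (openConn a b) *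
          (prodBernoulli w).real {ω | ω ∈ openConnIn (insert a ((↑(insert x (insert b A)) : Set (Fin n))ᶜ)) o a ∧
            ∀ a' ∈ A, ω ∈ openConnIn (insert a' ((↑(insert x (insert b A)) : Set (Fin n))ᶜ)) o a' →
              ((prodBernoulli w).real (openConn a' b)ᶜ < (prodBernoulli w).real (openConn a b)ᶜ ∨
                ((prodBernoulli w).real (openConn a' b)ᶜ = (prodBernoulli w).real (openConn a b)ᶜ ∧ a' ≤ a))}) →
    (∀ (n : ℕ) (w : Sym2 (Fin n) → unitInterval) (A : Finset (Fin n)) (o b : Fin n), o ∉ A → b ∈ A →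
      (prodBernoulli w).real {ω | ω ∉ openConn o b ∧
          ∃ a ∈ A, ω ∈ openConnIn (insert a ((↑A : Set (Fin n))ᶜ)) o a} ≤
        ∑ a ∈ A, (prodBernoulli w).real (openConn a b)ᶜ *
          (prodBernoulli w).real {ω | ω ∈ openConnIn (insert a ((↑A : Set (Fin n))ᶜ)) o a ∧
            ∀ a' ∈ A, ω ∈ openConnIn (insert a' ((↑A : Set (Fin n))ᶜ)) o a' →
              ((prodBernoulli w).real (openConn a' b)ᶜ < (prodBernoulli w).real (openConn a b)ᶜ ∨
                ((prodBernoulli w).real (openConn a' b)ᶜ = (prodBernoulli w).real (openConn a b)ᶜ ∧ a' ≤ a))}) :=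
  Summit.CriticalPhenomena.PercolationContinuityZ3.Theorems.stub_maxattOfGl3

/-- STUB (lead c4; size S–M; sources: `knLemma3i` with `a₁ = x`, `a₂ = o`, `Q = F` — `F` is increasing in the open edge
cluster of `o`: rewrite each `openConnIn S o a` as `openConnIn S a o` (symmetry of `Reachable`) and use
`maxattTwo_openConnIn_mono_openEdgeCluster` (Theorems/PercNearOneGluingNearOneGluingMaxattTwo.lean); `maxattGlue_sel_pairwiseDisjoint`
+ `measureReal_biUnion_finset` for `Σ_a μ(Sel_F a) ≤ μ(F)`).  **GL3 holds when the source is reliable enough**: under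
`μ(x ↔ b) ≤ μ(o ↔ b)` OR `Σ_{a∈A} μ(a ↔ b) μ(a selected on F) ≤ μ(o ↔ b) μ(F)` (the source is at least as reliable as the outsider,
or as the average selected member), the conclusion of `stub_gl3` holds for `(A, o, b, x)`.  Proof: case `μ(x↔b) ≤ μ(o↔b)`:
`knLemma3i` with `d = 0` gives `μ(F ∩ {x↔b}) ≤ μ(F ∩ {o↔b})`, and `Σ_a μ(a↔b) μ(Sel_F a) ≤ μ(x↔b) Σ_a μ(Sel_F a) ≤ μ(x↔b) μ(F)`
(hypothesis `μ(a↔b) ≤ μ(x↔b)` on `A`, disjointness of the selection events inside `F`); case `μ(x↔b) > μ(o↔b)`: `knLemma3i` with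
`d = μ(x↔b) − μ(o↔b)` gives `μ(F ∩ {x↔b}) − μ(x↔b) μ(F) ≤ μ(F ∩ {o↔b}) − μ(o↔b) μ(F) ≤ μ(F ∩ {o↔b}) − Σ_a μ(a↔b) μ(Sel_F a)` by the
second disjunct (the first being excluded).  This isolates the HARD regime of GL3: `o` less reliable than the outsider and than
the average selected relay — exactly the crux's regime. -/
theorem stub_gl3OfReliableSource :
    ∀ (n : ℕ) (w : Sym2 (Fin n) → unitInterval) (A : Finset (Fin n)) (o b x : Fin n), o ∉ A → b ∉ A → x ∉ A →
      (∀ a ∈ A, (prodBernoulli w).real (openConn a b) ≤ (prodBernoulli w).real (openConn x b)) →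
      ((prodBernoulli w).real (openConn x b) ≤ (prodBernoulli w).real (openConn o b) ∨
        ∑ a ∈ A, (prodBernoulli w).real (openConn a b) *
          (prodBernoulli w).real {ω | ω ∈ openConnIn (insert a ((↑(insert x (insert b A)) : Set (Fin n))ᶜ)) o a ∧
            ∀ a' ∈ A, ω ∈ openConnIn (insert a' ((↑(insert x (insert b A)) : Set (Fin n))ᶜ)) o a' →
              ((prodBernoulli w).real (openConn a' b)ᶜ < (prodBernoulli w).real (openConn a b)ᶜ ∨
                ((prodBernoulli w).real (openConn a' b)ᶜ = (prodBernoulli w).real (openConn a b)ᶜ ∧ a' ≤ a))} ≤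
          (prodBernoulli w).real (openConn o b) *
            (prodBernoulli w).real {ω | ∃ a ∈ A, ω ∈ openConnIn (insert a ((↑(insert x (insert b A)) : Set (Fin n))ᶜ)) o a}) →
      (prodBernoulli w).real (openConn x b ∩
          {ω | ∃ a ∈ A, ω ∈ openConnIn (insert a ((↑(insert x (insert b A)) : Set (Fin n))ᶜ)) o a}) -
        (prodBernoulli w).real (openConn x b) *
          (prodBernoulli w).real {ω | ∃ a ∈ A, ω ∈ openConnIn (insert a ((↑(insert x (insert b A)) : Set (Fin n))ᶜ)) o a} ≤
      (prodBernoulli w).real (openConn o b ∩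
          {ω | ∃ a ∈ A, ω ∈ openConnIn (insert a ((↑(insert x (insert b A)) : Set (Fin n))ᶜ)) o a}) -
        ∑ a ∈ A, (prodBernoulli w).real (openConn a b) *
          (prodBernoulli w).real {ω | ω ∈ openConnIn (insert a ((↑(insert x (insert b A)) : Set (Fin n))ᶜ)) o a ∧
            ∀ a' ∈ A, ω ∈ openConnIn (insert a' ((↑(insert x (insert b A)) : Set (Fin n))ᶜ)) o a' →
              ((prodBernoulli w).real (openConn a' b)ᶜ < (prodBernoulli w).real (openConn a b)ᶜ ∨
                ((prodBernoulli w).real (openConn a' b)ᶜ = (prodBernoulli w).real (openConn a b)ᶜ ∧ a' ≤ a))} :=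
  Summit.CriticalPhenomena.PercolationContinuityZ3.Theorems.stub_gl3OfReliableSource

/-! ### Cycle 4, second half: the glued-graph reduction of `|A| = 3` and its correlation lemmas

Exact identity (lab/testMp.c of lead c4; Cruxes/NearOneGluing/NOTES.md §E.7): for relays `x ≥ y ≥ z` (by reliability) and the glued graph
`G* = G/{y,z}` (attachment event of the glued vertex = `Y ∪ Zt`), `MAXATT₃(G)-slack = MAXATT₂(G*)-slack + Σ_R [μ(f_R) μ(R) − μ(R ∩ f_R)]`
over the representative pieces `R ∈ {Zt, Y ∖ Zt, X ∖ F}` with `f_R =` "the representative of `R` is dead in `G` but alive in `G*`"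
(`f_Zt = {z ↮ b} ∩ {y ↔ b}`, `f_{Y∖Zt} = {y ↮ b} ∩ {z ↔ b}`).  `MAXATT₂(G*)` is `stub_maxattTwo` in the glued graph, so `MAXATT₃` follows from the
NEGATIVE-CORRELATION statement (M): `Σ_R [μ(f_R) μ(R) − μ(R ∩ f_R)] ≥ 0` (0 violations; LRF-order-sensitive).  The two stubs below are the
provable correlation lemmas of this programme (BHK 2006 Thm 1.5 for the pair `(y, z)`): the `Zt`-term of (M) is nonnegative outright, and the
`Y ∖ Zt`-term is bounded through `μ(Y ∩ {y ↮ z})`. -/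

/-- STUB (lead c4; LANDED p140783 as `Theorems.stub_attachRescueNegCorr`; BHK 2006 Thm 1.5 for the pair `(y, z)` + Harris).
**Attachment is nonpositively correlated with "dead but the colleague alive"**: for `Zt = {o ↔ z inside S}` and
`f = {z ↮ b} ∩ {y ↔ b}`, `μ(Zt ∩ f) ≤ μ(Zt) · μ(f)` — the `Zt`-term of (M) is nonnegative. -/
theorem stub_attachRescueNegCorr :
    ∀ (n : ℕ) (w : Sym2 (Fin n) → unitInterval) (S : Set (Fin n)) (o b y z : Fin n),
      (prodBernoulli w).real (openConnIn S o z ∩ ((openConn z b)ᶜ ∩ openConn y b)) ≤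
        (prodBernoulli w).real (openConnIn S o z) * (prodBernoulli w).real ((openConn z b)ᶜ ∩ openConn y b) :=
  Summit.CriticalPhenomena.PercolationContinuityZ3.Theorems.stub_attachRescueNegCorr

/-- STUB (lead c4; LANDED p141039 as `Theorems.stub_attachAloneRescueBound`; BHK 2006 Thm 1.5 for `(y, z)`).
**"`y` attached, `z` not" is nonpositively correlated with "`z` alive, `y` dead", given `y ↮ z`**: with
`Y = {o ↔ y inside S}`, `Zt = {o ↔ z inside S'}`, `D = {y ↮ z}`, `g = {z ↔ b} ∩ {y ↮ b} ⊆ D`: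
`μ(D) · μ((Y ∖ Zt) ∩ g) ≤ μ((Y ∖ Zt) ∩ D) · μ(g)`. -/
theorem stub_attachAloneRescueBound :
    ∀ (n : ℕ) (w : Sym2 (Fin n) → unitInterval) (S S' : Set (Fin n)) (o b y z : Fin n),
      (prodBernoulli w).real (openConn y z)ᶜ *
          (prodBernoulli w).real ((openConnIn S o y \ openConnIn S' o z) ∩ (openConn z b ∩ (openConn y b)ᶜ)) ≤
        (prodBernoulli w).real ((openConnIn S o y \ openConnIn S' o z) ∩ (openConn y z)ᶜ) *
          (prodBernoulli w).real (openConn z b ∩ (openConn y b)ᶜ) :=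
  Summit.CriticalPhenomena.PercolationContinuityZ3.Theorems.stub_attachAloneRescueBound

/-! ### The two-relay RESCUE inequality and the strong form of MAXATT₂ (lead c4, 04:40Z)

Exact decomposition (no gluing needed): for relays `x ≥ y ≥ z`, `F = Y ∪ Zt`, `W-alive := {y ↔ b} ∪ {z ↔ b}`,
`MAXATT₃-slack = [Cov(1_F, 1_{W-alive}) − Cov(1_F, 1_{x↔b})] + HarrisSlack(x; X ∪ F) + R₁ + R₂` and the family slack
`S_F = Cov(1_F, 1_{W-alive}) + R₁ + R₂`, where `R₁ := μ(f₁)μ(Zt) − μ(Zt ∩ f₁)`, `R₂ := μ(f₂)μ(Y∖Zt) − μ((Y∖Zt) ∩ f₂)`,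
`f₁ = {z ↮ b} ∩ {y ↔ b}`, `f₂ = {y ↮ b} ∩ {z ↔ b}`.  THEOREM (`stub_rescueTwo`, from the two landed BHK-1.5 lemmas + Harris twice):
`R₁ + R₂ ≥ 0` whenever `μ(z ↔ b) ≤ μ(y ↔ b)`; COROLLARY (`stub_maxattTwoStrong`): `bad(F) ≤ u_z μ(Zt) + u_y μ(Y∖Zt) − Cov(1_F, 1_{W-alive})`,
a strict strengthening of `stub_maxattTwo`.  What is left of `|A| = 3` after this: `Cov(1_F, 1_{x↔b}) ≤ Cov(1_F, 1_{W-alive}) + R₁ + R₂ (+ Harris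
slack)`; the naive "set Lemma 3" `Cov(F, x) ≤ Cov(F, W-alive)` is false (93/963, lab/testM3u.c), the full inequality has 0 violations. -/

/-- STUB (lead c4; LANDED p142286 as `Theorems.stub_rescueTwo`).  **Two-relay rescue inequality (RESCUE₂).**  For
`Y := openConnIn S o y`, `Zt := openConnIn S' o z`, `f₁ := {z ↮ b} ∩ {y ↔ b}`, `f₂ := {y ↮ b} ∩ {z ↔ b}` and
`μ(z ↔ b) ≤ μ(y ↔ b)`: `μ(Zt ∩ f₁) + μ((Y ∖ Zt) ∩ f₂) ≤ μ(Zt) μ(f₁) + μ(Y ∖ Zt) μ(f₂)`.  From BHK Thm 1.5 twice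
(`stub_attachRescueNegCorr`, `stub_attachAloneRescueBound`), Harris twice, and `μ(f₂) ≤ μ(f₁)` (⟸ the order). -/
theorem stub_rescueTwo :
    ∀ (n : ℕ) (w : Sym2 (Fin n) → unitInterval) (S S' : Set (Fin n)) (o b y z : Fin n),
      (prodBernoulli w).real (openConn z b) ≤ (prodBernoulli w).real (openConn y b) →
      (prodBernoulli w).real (openConnIn S' o z ∩ ((openConn z b)ᶜ ∩ openConn y b)) +
          (prodBernoulli w).real ((openConnIn S o y \ openConnIn S' o z) ∩ ((openConn y b)ᶜ ∩ openConn z b)) ≤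
        (prodBernoulli w).real (openConnIn S' o z) * (prodBernoulli w).real ((openConn z b)ᶜ ∩ openConn y b) +
          (prodBernoulli w).real (openConnIn S o y \ openConnIn S' o z) *
            (prodBernoulli w).real ((openConn y b)ᶜ ∩ openConn z b) :=
  Summit.CriticalPhenomena.PercolationContinuityZ3.Theorems.stub_rescueTwo

/-- STUB (lead c4; LANDED p142912 as `Theorems.stub_maxattTwoStrong`).  **Strong two-relay MAXATT**: with
`X = {o ↔ x inside {v ≠ b, v ≠ y}}`, `Y = {o ↔ y inside {v ≠ b, v ≠ x}}`, `F = X ∪ Y`, `Wal = {x ↔ b} ∪ {y ↔ b}` and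
`μ(y ↔ b) ≤ μ(x ↔ b)`: `μ(o ↮ b, F) + [μ(F ∩ Wal) − μ(F) μ(Wal)] ≤ μ(y ↮ b)·μ(Y) + μ(x ↮ b)·μ(X ∖ Y)` — an exact
rewriting of `stub_rescueTwo`; strictly stronger than `stub_maxattTwo` (the bracket is `≥ 0` by Harris). -/
theorem stub_maxattTwoStrong :
    ∀ (n : ℕ) (w : Sym2 (Fin n) → unitInterval) (o b x y : Fin n),
      (prodBernoulli w).real (openConn y b) ≤ (prodBernoulli w).real (openConn x b) →
      (prodBernoulli w).real {ω | ω ∉ openConn o b ∧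
          (ω ∈ openConnIn {v : Fin n | v ≠ b ∧ v ≠ y} o x ∨ ω ∈ openConnIn {v : Fin n | v ≠ b ∧ v ≠ x} o y)} +
        ((prodBernoulli w).real ((openConnIn {v : Fin n | v ≠ b ∧ v ≠ y} o x ∪ openConnIn {v : Fin n | v ≠ b ∧ v ≠ x} o y) ∩
              (openConn x b ∪ openConn y b)) -
          (prodBernoulli w).real (openConnIn {v : Fin n | v ≠ b ∧ v ≠ y} o x ∪ openConnIn {v : Fin n | v ≠ b ∧ v ≠ x} o y) *
            (prodBernoulli w).real (openConn x b ∪ openConn y b)) ≤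
        (prodBernoulli w).real (openConn y b)ᶜ *
            (prodBernoulli w).real (openConnIn {v : Fin n | v ≠ b ∧ v ≠ x} o y) +
          (prodBernoulli w).real (openConn x b)ᶜ *
            (prodBernoulli w).real
              (openConnIn {v : Fin n | v ≠ b ∧ v ≠ y} o x \ openConnIn {v : Fin n | v ≠ b ∧ v ≠ x} o y) :=
  Summit.CriticalPhenomena.PercolationContinuityZ3.Theorems.stub_maxattTwoStrong

/-! ### RESCUE — the reliability-free core (lead c4, 05:40Z)

EXACT IDENTITY (lab/rescue.c, verified to 1e-9 on every instance): for `b ∉ A`, pockets avoiding `A ∪ {b}`, LRF selection `Sel a`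
(least reliable attached member of `A`), `Zall := ⋃ Sel a = {some member attached}`, `Alive := ⋃_{a∈A} {a ↔ b}`:
    MAXATT-slack(A ∪ {b}) = Cov(1_Zall, 1_Alive) + Σ_{a∈A} [μ(Sel a) μ(g a) − μ(Sel a ∩ g a)],   g a := {a ↮ b} ∩ Alive,
with `Cov(1_Zall, 1_Alive) ≥ 0` by Harris.  Hence MAXATT ⟸ RESCUE := "Σ_a [μ(Sel a) μ(g a) − μ(Sel a ∩ g a)] ≥ 0": the LRF
representative is no more likely to be "dead while the family survives" in its own world than in a fresh one.  RESCUE contains no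
reliabilities except through the ORDER defining `Sel`; 0 violations for |A| = 2..5 (1435/1455/1480/938 exact instances), and it FAILS
for the reversed order (17–37 %).  |A| = 2 is the landed `stub_rescueTwo`; RESCUE₃ = RESCUE₂(y,z) + RESCUE₂(G/yz; x, w) − Cov(1_{X∖F}, 1_{f_x})
(recursive glued structure, `f_x` = "x dead but rescued by gluing y,z"). -/

/-- STUB (lead c4; CONJECTURAL — "RESCUE", implies MAXATT hence KN Conjecture 1 and the crux).  For `o ∉ A`, `b ∉ A`, with
`Att a := openConnIn (insert a (↑(insert b A))ᶜ) o a`, `Sel a := Att a ∧ ∀ a' ∈ A, Att a' → ((u a' < u a) ∨ (u a' = u a ∧ a' ≤ a))`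
(`u v := μ(v ↮ b)`), `Alive := ⋃_{a ∈ A} openConn a b`:  `Σ_{a∈A} μ(Sel a ∩ ((openConn a b)ᶜ ∩ Alive)) ≤ Σ_{a∈A} μ(Sel a) · μ((openConn a b)ᶜ ∩ Alive)`.
Evidence: Lines/SketchR2I5 notes §E.8; lab/rescue.c.  |A| = 2 = `stub_rescueTwo` (landed p142286). -/
theorem stub_rescue :
    ∀ (n : ℕ) (w : Sym2 (Fin n) → unitInterval) (A : Finset (Fin n)) (o b : Fin n), o ∉ A → b ∉ A →
      ∑ a ∈ A, (prodBernoulli w).real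
          ({ω | ω ∈ openConnIn (insert a ((↑(insert b A) : Set (Fin n))ᶜ)) o a ∧
              ∀ a' ∈ A, ω ∈ openConnIn (insert a' ((↑(insert b A) : Set (Fin n))ᶜ)) o a' →
                ((prodBernoulli w).real (openConn a' b)ᶜ < (prodBernoulli w).real (openConn a b)ᶜ ∨
                  ((prodBernoulli w).real (openConn a' b)ᶜ = (prodBernoulli w).real (openConn a b)ᶜ ∧ a' ≤ a))} ∩
            ((openConn a b)ᶜ ∩ ⋃ a' ∈ A, openConn a' b)) ≤
        ∑ a ∈ A, (prodBernoulli w).real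
            {ω | ω ∈ openConnIn (insert a ((↑(insert b A) : Set (Fin n))ᶜ)) o a ∧
              ∀ a' ∈ A, ω ∈ openConnIn (insert a' ((↑(insert b A) : Set (Fin n))ᶜ)) o a' →
                ((prodBernoulli w).real (openConn a' b)ᶜ < (prodBernoulli w).real (openConn a b)ᶜ ∨
                  ((prodBernoulli w).real (openConn a' b)ᶜ = (prodBernoulli w).real (openConn a b)ᶜ ∧ a' ≤ a))} *
          (prodBernoulli w).real ((openConn a b)ᶜ ∩ ⋃ a' ∈ A, openConn a' b) := by
  sorry

/-- STUB (lead c4; size M–L; sources: the bookkeeping of `stub_maxattOfGl3` (Theorems/…MaxattOfGl3.lean: `maxattOfGl3_real_setOf_exists_eq_sum`,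
`maxattOfGl3_bookkeeping`, lex-minimum handling) and of `stub_maxattTwoStrong`; Harris `prodBernoulli_harris` for `Zall` and `Alive`
(both unions of increasing events); `maxattGlue_sel_pairwiseDisjoint`).  **RESCUE implies MAXATT.**  Hypothesis = `stub_rescue` verbatim, conclusion =
`stub_maxattGluing` verbatim.  Proof route for MAXATT's `(A ∋ b, o ∉ A)`: put `A₀ := A.erase b` and apply RESCUE to `A₀` (`insert b A₀ = A`, so its
attachment/selection events are MAXATT's restricted to `A₀`; the `b`-terms of MAXATT vanish: `μ(b ↮ b) = 0`, and `Att b ⊆ {o ↔ b}`).  With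
`Zall := {∃ a ∈ A₀, Att a} = ⊔_a Sel a` and `Alive := ⋃_{a∈A₀} {a ↔ b}`: on `Sel a`, `o ↔ b ⟺ a ↔ b` (a ∈ C(o)), so
`μ(o ↔ b, Zall) = Σ_a μ(Sel a ∩ {a↔b}) = Σ_a [μ(Sel a ∩ Alive) − μ(Sel a ∩ g a)] = μ(Zall ∩ Alive) − Σ_a μ(Sel a ∩ g a)`, and
`Σ_a μ(a↔b) μ(Sel a) = Σ_a [μ(Alive) − μ(g a)] μ(Sel a) = μ(Alive) μ(Zall) − Σ_a μ(g a) μ(Sel a)` (`{a↔b} ⊔ g a = Alive`); hence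
`MAXATT-slack = [μ(Zall ∩ Alive) − μ(Zall) μ(Alive)] + RESCUE-sum ≥ 0 + 0` (Harris: `Zall`, `Alive` increasing).  Finally
`bad = μ(o ↮ b, ∃ a ∈ A, Att a) = μ(Zall) − μ(o ↔ b, Zall)` and MAXATT's right side `= Σ_{a∈A₀} μ(a ↮ b) μ(Sel_A a) ≥ Σ_{a ∈ A₀} μ(a↮b) μ(Sel a)`
with `Sel_A a ⊇ Sel a` for `μ(a ↮ b) > 0` (b never beats such an `a`; careful: MAXATT's selection quantifies over `a' ∈ A` incl. `b`, with
`u b = 0`). -/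
theorem stub_maxattOfRescue :
    (∀ (n : ℕ) (w : Sym2 (Fin n) → unitInterval) (A : Finset (Fin n)) (o b : Fin n), o ∉ A → b ∉ A →
      ∑ a ∈ A, (prodBernoulli w).real
          ({ω | ω ∈ openConnIn (insert a ((↑(insert b A) : Set (Fin n))ᶜ)) o a ∧
              ∀ a' ∈ A, ω ∈ openConnIn (insert a' ((↑(insert b A) : Set (Fin n))ᶜ)) o a' →
                ((prodBernoulli w).real (openConn a' b)ᶜ < (prodBernoulli w).real (openConn a b)ᶜ ∨
                  ((prodBernoulli w).real (openConn a' b)ᶜ = (prodBernoulli w).real (openConn a b)ᶜ ∧ a' ≤ a))} ∩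
            ((openConn a b)ᶜ ∩ ⋃ a' ∈ A, openConn a' b)) ≤
        ∑ a ∈ A, (prodBernoulli w).real
            {ω | ω ∈ openConnIn (insert a ((↑(insert b A) : Set (Fin n))ᶜ)) o a ∧
              ∀ a' ∈ A, ω ∈ openConnIn (insert a' ((↑(insert b A) : Set (Fin n))ᶜ)) o a' →
                ((prodBernoulli w).real (openConn a' b)ᶜ < (prodBernoulli w).real (openConn a b)ᶜ ∨
                  ((prodBernoulli w).real (openConn a' b)ᶜ = (prodBernoulli w).real (openConn a b)ᶜ ∧ a' ≤ a))} *
          (prodBernoulli w).real ((openConn a b)ᶜ ∩ ⋃ a' ∈ A, openConn a' b)) →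
    (∀ (n : ℕ) (w : Sym2 (Fin n) → unitInterval) (A : Finset (Fin n)) (o b : Fin n), o ∉ A → b ∈ A →
      (prodBernoulli w).real {ω | ω ∉ openConn o b ∧
          ∃ a ∈ A, ω ∈ openConnIn (insert a ((↑A : Set (Fin n))ᶜ)) o a} ≤
        ∑ a ∈ A, (prodBernoulli w).real (openConn a b)ᶜ *
          (prodBernoulli w).real {ω | ω ∈ openConnIn (insert a ((↑A : Set (Fin n))ᶜ)) o a ∧
            ∀ a' ∈ A, ω ∈ openConnIn (insert a' ((↑A : Set (Fin n))ᶜ)) o a' →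
              ((prodBernoulli w).real (openConn a' b)ᶜ < (prodBernoulli w).real (openConn a b)ᶜ ∨
                ((prodBernoulli w).real (openConn a' b)ᶜ = (prodBernoulli w).real (openConn a b)ᶜ ∧ a' ≤ a))}) :=
  Summit.CriticalPhenomena.PercolationContinuityZ3.Theorems.stub_maxattOfRescue

/-! ### Cycle 5 (lead c5, 2026-08-17): the |A| = 3 kernel of RESCUE and its two provable set-lemmas

EXACT IDENTITY (lab/t_res3.c of lead c5, Cruxes/NearOneGluing/NOTES.md §F.2): for relays `x ≥ y ≥ z`, `W = {y, z}`,
`F = Y ∪ Zt` (= "some member of `W` attached"), `R12 =` the slack of `stub_rescueTwo`: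
    RESCUE₃ = R12 − Cov(1_F, 1_h) − Cov(1_{X∖F}, 1_{g′}) − Cov(1_{X∖F}, 1_{f_x}),
    h = {x ↔ b} ∩ {W ↮ b},  g′ = {x ↮ b} ∩ {W ↔ b} ∩ {x ↮ W},  f_x = {x ↮ b} ∩ {x ↔ W} ∩ {W ↔ b}.
The two stubs below are the SET versions (relay set `A` in the role of the single relay `z`, outsider `x` in the role of `y`)
of the landed `stub_attachRescueNegCorr` / `stub_attachAloneRescueBound`; they control the `h`-term (`Cov(F, h) ≤ 0`, with
Harris) and the BHK half of the `g′`-term, for EVERY sub-family `A` — the tools of the glued induction MAXATT_k ⟸ MAXATT₂(G/A′) + (M_k)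
(NOTES §E.6–E.8).  Both follow from the vertex versions on the hub-augmented graph `Option (Fin n)` (hub joined to `A` by weight-1
pairs: `Theorems/PercNearOneGluingAdditiveGluingBhkSetsAux.lean` — `bhkHub_integral`, `bhkHub_reachable_none_some`,
`bhkHub_reachable_some_some`) applied to `attachRescueNegCorr_twoCluster` / `attachAloneRescueBound_twoCluster` (generic vertex type).
0 violations in 8 000 exact instances with ARBITRARY `S, S₁` (lab/t_setresc.c).  What then remains of |A| = 3 is (N1)/(N3′) of NOTES §F.2.
The third stub, the TIE LEMMA (`stub_tieLemma`, found and proved this cycle), is the unconditional comparison `μ(f₁ ∩ {x↔z}) ≤ μ(f₂ ∩ {x↮y})`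
(x at least as reliable as y, z arbitrary) — the mechanism by which the x–z tie inside `f_x` is paid for by `f₂`; with it (N1) is a theorem at
depth one with `z` unattached (NOTES §F.8–F.9), the regime of all near-tight (N1) instances.  STATUS at the end of cycle 5: all three cycle-5
stubs LANDED (p147130, p149473, p149515); the file's sorries are the four conjecture-level ones only. -/

/-- STUB (lead c5; LANDED p147130 as `Theorems.stub_attachSetRescueNegCorr`; size M; sources: `attachRescueNegCorr_twoCluster` (Theorems/…AttachRescueNegCorr.lean, generic `V`), the hub
augmentation `bhkHub_integral` / `bhkHub_reachable_none_some` / `bhkHub_reachable_some_some` (Theorems/…AdditiveGluingBhkSetsAux.lean),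
`prodBernoulli_harris_upper_lower`, `isUpperSet_openConnIn`, `mem_openConnIn_iff_pathIn` / `pathIn_map`).
**Attachment of a relay SET is nonpositively correlated with "the set is dead but the outsider lives".**  For a relay set `A`,
pocket set `S`, source `o`, target `b`, outsider `x`, with `F_A := {∃ a ∈ A, o ↔ a inside insert a S}` and
`h := {∀ a ∈ A, a ↮ b} ∩ {x ↔ b}`:  `μ(F_A ∩ h) ≤ μ(F_A) · μ(h)`.
Proof route: on `Option (Fin n)` with the hub `none` joined to `A` (weights `hubW⟦A, w⟧`), `F_A` is the pull-back of
`Q′ := {∃ a ∈ A, s(none, some a) open ∧ some o ↔ some a inside some '' (insert a S)}` (up-closed in the open edge cluster of the hub),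
`h` is the pull-back of `{none ↮ some b} ∩ {some x ↔ some b}` on `{some x ↮ none}` = pull-back `{x ↮ A}`; apply
`attachRescueNegCorr_twoCluster (hubW) (some x) none (some b) Q′`, transport the four measures with `bhkHub_integral`
(indicator integrands), and finish with Harris for `F_A` (increasing) and `{x ↮ A}` (decreasing) exactly as in `stub_attachRescueNegCorr`. -/
theorem stub_attachSetRescueNegCorr :
    ∀ (n : ℕ) (w : Sym2 (Fin n) → unitInterval) (A : Finset (Fin n)) (S : Set (Fin n)) (o b x : Fin n),
      (prodBernoulli w).real ({ω | ∃ a ∈ A, ω ∈ openConnIn (insert a S) o a} ∩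
          ({ω | ∀ a ∈ A, ω ∉ openConn a b} ∩ openConn x b)) ≤
        (prodBernoulli w).real {ω | ∃ a ∈ A, ω ∈ openConnIn (insert a S) o a} *
          (prodBernoulli w).real ({ω | ∀ a ∈ A, ω ∉ openConn a b} ∩ openConn x b) :=
  -- LANDED p147130 (stub-worker of lead c5, 288 lines, hub augmentation)
  Summit.CriticalPhenomena.PercolationContinuityZ3.Theorems.stub_attachSetRescueNegCorr

/-- STUB (lead c5; LANDED p149473 as `Theorems.stub_attachAloneSetRescueBound`; size M; sources: `attachAloneRescueBound_twoCluster` (Theorems/…AttachAloneRescueBound.lean, generic `V`), the hub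
augmentation (Theorems/…AdditiveGluingBhkSetsAux.lean), `maxattTwo_openConnIn_mono_openEdgeCluster`).
**"The outsider attached, the set not" is nonpositively correlated with "the set lives, the outsider is dead", given that the
outsider is not joined to the set.**  With `X := {o ↔ x inside S₁}`, `F_A := {∃ a ∈ A, o ↔ a inside insert a S}`,
`D := {∀ a ∈ A, x ↮ a}` and `g′ := (⋃_{a ∈ A} {a ↔ b}) ∩ {x ↮ b} ∩ D`:  `μ(D) · μ((X ∖ F_A) ∩ g′) ≤ μ((X ∖ F_A) ∩ D) · μ(g′)`.
Proof route: hub augmentation as for `stub_attachSetRescueNegCorr`; in the augmented graph this is `attachAloneRescueBound_twoCluster`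
with `s = some x`, `t = none`, `P =` the lift of `X` (`openConnIn (some '' S₁) (some o) (some x)`, up-closed in `C_{some x}`),
`Q = Q′` (up-closed in `C_none`), `b ↦ some b`: it gives `μ′(D′ ∩ (P ∖ Q)) μ′(D′ ∩ {none ↮ some b}) ≤ μ′(D′) μ′(D′ ∩ (P ∖ Q) ∩ {none ↮ some b})`;
transport (`bhkHub_integral`), rewrite `{none ↔ some b} = {A ↔ b}`, `D′ = {x ↮ A}`, and pass to complements inside `D′`
(`D′ ∩ {A ↔ b} ∩ … = g′`-bookkeeping as in `stub_attachAloneRescueBound`). -/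
theorem stub_attachAloneSetRescueBound :
    ∀ (n : ℕ) (w : Sym2 (Fin n) → unitInterval) (A : Finset (Fin n)) (S S₁ : Set (Fin n)) (o b x : Fin n),
      (prodBernoulli w).real {ω | ∀ a ∈ A, ω ∉ openConn x a} *
          (prodBernoulli w).real ((openConnIn S₁ o x \ {ω | ∃ a ∈ A, ω ∈ openConnIn (insert a S) o a}) ∩
            (((⋃ a ∈ A, openConn a b) ∩ (openConn x b)ᶜ) ∩ {ω | ∀ a ∈ A, ω ∉ openConn x a})) ≤
        (prodBernoulli w).real ((openConnIn S₁ o x \ {ω | ∃ a ∈ A, ω ∈ openConnIn (insert a S) o a}) ∩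
            {ω | ∀ a ∈ A, ω ∉ openConn x a}) *
          (prodBernoulli w).real (((⋃ a ∈ A, openConn a b) ∩ (openConn x b)ᶜ) ∩ {ω | ∀ a ∈ A, ω ∉ openConn x a}) :=
  -- LANDED p149473 (stub-worker of lead c5 + lead, 185 lines, hub augmentation)
  Summit.CriticalPhenomena.PercolationContinuityZ3.Theorems.stub_attachAloneSetRescueBound

/-- STUB (lead c5; LANDED p149515 as `Theorems.stub_tieLemma`; sources:
`knLemma3i_twoCluster` (BHK 2006 Thm 1.4) and `knLemma3i_oneCluster` (BHK Thm 1.3) for the pair of sources `(x, y)` given `{x ↮ y}`,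
`pivDom_openConn_mono_openEdgeCluster`).  **Tie lemma.**  If `μ(y ↔ b) ≤ μ(x ↔ b)` then for EVERY `z`:
`μ(z ↮ b, y ↔ b, x ↔ z) ≤ μ(y ↮ b, z ↔ b, x ↮ y)` — in kernel notation `μ(f₁ ∩ {x↔z}) ≤ μ(f₂ ∩ {x↮y})`, whence
`μ(f_x) ≤ μ(f₂)` for the glued-rescue event `f_x = (f₂ ∩ {x↔y}) ⊔ (f₁ ∩ {x↔z})` of the x-term.  It is exactly the inequality to
which (N1) reduces at depth one with `z` unattached (NOTES §F.8: `T_x ≤ R12 ⟺ (1−p_x)μ_H(f₂, x alive) + p_x[μ_H(f₂, x↮y) − μ_H(f₁, x↔z)] ≥ 0`),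
so that case of (N1) is now a theorem.  Proof: `x↔z↮b ⟹ x↮b ⟹ x↮y` (y alive); BHK 1.4 decouples `{y↔b}` from `{x↔z}` given `x↮y`;
the hypothesis transfers to the conditional (`{x↔y↔b}` cancels); BHK 1.3 recouples `{x↔b}` with `{x↔z}`; `x↔b ∧ x↮y ⟹ y↮b`. -/
theorem stub_tieLemma :
    ∀ (n : ℕ) (w : Sym2 (Fin n) → unitInterval) (b x y z : Fin n),
      (prodBernoulli w).real (openConn y b) ≤ (prodBernoulli w).real (openConn x b) →
      (prodBernoulli w).real ((openConn z b)ᶜ ∩ openConn y b ∩ openConn x z) ≤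
        (prodBernoulli w).real ((openConn y b)ᶜ ∩ openConn z b ∩ (openConn x y)ᶜ) :=
  -- LANDED p149515 (lead c5, 130 lines)
  Summit.CriticalPhenomena.PercolationContinuityZ3.Theorems.stub_tieLemma

/-- **`NearOneGluing` from RESCUE** (real composition: RESCUE ⟹ MAXATT ⟹ crux). -/
theorem NearOneGluing_of_rescue :
    Summit.CriticalPhenomena.PercolationContinuityZ3.Theses.PercNearOneGluing.NearOneGluing :=
  stub_maxattGlue (stub_maxattOfRescue stub_rescue)

/-- **`NearOneGluing` from the MAXATT route** (real composition: `stub_maxattGlue` applied to `stub_maxattGluing`). -/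
theorem NearOneGluing_of_maxatt :
    Summit.CriticalPhenomena.PercolationContinuityZ3.Theses.PercNearOneGluing.NearOneGluing :=
  stub_maxattGlue stub_maxattGluing

/-- **`NearOneGluing` from the generalized Lemma 3** (real composition: GL3 ⟹ MAXATT ⟹ crux). -/
theorem NearOneGluing_of_gl3 :
    Summit.CriticalPhenomena.PercolationContinuityZ3.Theses.PercNearOneGluing.NearOneGluing :=
  stub_maxattGlue (stub_maxattOfGl3 stub_gl3)


/-! ## Cycles 6–7 (leads c6, c7, 2026-08-17): Kozma–Nitzan Question 7 / Conjecture 1 for THREE relays from two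
exchange-slack stubs

Lead c6 landed the chain `Q7₃ ⟸ (R3) ⟸ (R3″) ⟸ S12 ⟸ S1 ∧ S2` (Theorems/…Q7ThreeCut, …R3OfR3pp, …R3ppOfS12, …Q7ThreeOfExch,
…Exch0; p155715, p161356, p161547, p163414, p161380).  Notation: `D := {y ↮ z}`, `D_a := {x ↮ y} ∩ {x ↮ z}`,
`W := D_a ∩ {o ↔ x}`, `θ := μ(W)/μ(D_a)`, `σ₁(Q) := μ(D)μ(Q ∩ yb ∩ D) − μ(Q ∩ D)μ(yb ∩ D)` (BHK-1.3 slack of `Q` against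
`{y↔b}` under `D`), `σ₂(Q) := μ(Q ∩ D)μ(zb ∩ D) − μ(D)μ(Q ∩ zb ∩ D)` (BHK-1.4 slack against `{z↔b}`).  The two OPEN stubs say
`θ·σᵢ({x↔y}) ≤ σᵢ({o↔y})` (i = 1, 2): the BHK slack of the source event `{o ∈ C_y}` dominates `θ` times the slack of
`{x ∈ C_y}`, `θ = P(o ↔ x | x ↮ y, x ↮ z)` — instances `F = 1{y↔b}`, `F = −1{z↔b}` of the exchange inequality
`Cov(1{o∈C_y} − θ·1{x∈C_y}, F | y ↮ z) ≥ 0` (F increasing in `C_y`, decreasing in `C_z`), whose z-free form is the landed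
`stub_exch0`.  0 violations in > 2·10⁴ exact instances (c6: all coincidences; c7: independent engine lab/part.c), multivariate
Bernstein (profile) coefficients all ≥ 0 (c6 §G.7).  Lead c7 anatomy (NOTES §H): with `η := 1{y↔b} − 1{z↔b}`,
`T_z = t1 + t3 + t5 + s₂ + (r_y − r_z)T1′ + θ(r_x − r_z)` exactly, where `t3, t5, s₂, T1′ ≥ 0` are BHK-1.5 / Lemma-1 facts and
`t1 = μ(D)·Cov(1{o ↔ {x,y}}, η | D)` is the only sign-indefinite piece; `S12 = t1 + t3 + t5`.
These stubs do NOT close the crux; they settle its first open finite case (|A| = 3 of MAXATT / GL3 / RESCUE / KN Conj 1). -/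

/-- STUB (lead c7, wave 4; OPEN — registered `stub_innerHole`; the ONE residual of the |A| = 3 case).
**Hole-averaged exchange covariance INNER ≥ 0**: for every monotone functional `H` of the open edge cluster of `y`,
`Σ_Z μ(C_z = Z; y↮z) · Cov_{G−V(Z)}( μ(D_a)·1{o↔y} − μ(W)·1{x↔y}, H(C_y) ) ≥ 0` — inside the hole left by `z`'s cluster the
percolation is UNCONDITIONED, and the exchange covariance with the ORIGINAL constant `θ = μ(W)/μ(D_a)`, averaged over the hole law,
is nonnegative (worker W7 report work/stubs/CexchS1.md §3; 0 violations in ≈10⁶ exact instances, n ≤ 9, all up-sets of vertex- and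
edge-clusters).  The landed chain `Theorems.exch_stubs_of_innerHole` (p171562 ← p171514 hole-resampling telescoping S(G) − S(TG) = μ(D)·INNER,
monotone + Doeblin ← p171104, p170911 S1/S2 as instances of S1-gen, weight continuity for weights = 1) turns it into BOTH registered
exchange stubs.  The sharp residuals of wave 3 (`stub_s2M`, `stub_cexchS1`, registered, still open and still implied targets) are no
longer on the composition path. -/
theorem stub_innerHole :
    ∀ (n : ℕ) (w : Sym2 (Fin n) → unitInterval) (o x y z : Fin n) (H : Set (Sym2 (Fin n)) → ℝ), Monotone H → 0 ≤ (∑ ω : Set (Sym2 (Fin n)), Literature.Probability.Percolation.BHK2006.weight (fun e => ((w e : unitInterval) : ℝ)) ω * (((Literature.Probability.LatticeModels.prodBernoulli w).real ((Literature.Probability.Percolation.openConn x y)ᶜ ∩ (Literature.Probability.Percolation.openConn x z)ᶜ) * Literature.Probability.Percolation.connIndicatorFn y o (Literature.Probability.Percolation.openEdgeCluster ω y) - (Literature.Probability.LatticeModels.prodBernoulli w).real (((Literature.Probability.Percolation.openConn x y)ᶜ ∩ (Literature.Probability.Percolation.openConn x z)ᶜ) ∩ Literature.Probability.Percolation.openConn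 o x) * Literature.Probability.Percolation.connIndicatorFn y x (Literature.Probability.Percolation.openEdgeCluster ω y)) * H (Literature.Probability.Percolation.openEdgeCluster ω y) * Literature.Probability.Percolation.DecisionTree.ind ((Literature.Probability.Percolation.openConn y z)ᶜ) ω)) - (∑ ω : Set (Sym2 (Fin n)), Literature.Probability.Percolation.BHK2006.weight (fun e => ((w e : unitInterval) : ℝ)) ω * ((∑ η : Set (Sym2 (Fin n)), Literature.Probability.Percolation.BHK2006.weight (fun e => ((w e : unitInterval) : ℝ)) η * ((Literature.Probability.LatticeModels.prodBernoulli w).real ((Literature.Probability.Percolation.openConn x y)ᶜ ∩ (Literature.Probability.Percolation.openConn x z)ᶜ) * Literature.Probability.Percolation.connIndicatorFn y o (Literature.Probability.Percolation.openEdgeCluster (η \ {e : Sym2 (Fin n) | ∃ u ∈ e, u = z ∨ ∃ e' ∈ (Literature.Probability.Percolation.openEdgeCluster ω z), u ∈ e'}) y) - (Literature.Probability.LatticeModels.prodBernoulli w).real (((Literature.Probability.Percolation.openConn x y)ᶜ ∩ (Literature.Probability.Percolation.openConn x z)ᶜ) ∩ Literature.Probability.Percolation.openConn o x) * Literature.Probability.Percolation.connIndicatorFn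 y x (Literature.Probability.Percolation.openEdgeCluster (η \ {e : Sym2 (Fin n) | ∃ u ∈ e, u = z ∨ ∃ e' ∈ (Literature.Probability.Percolation.openEdgeCluster ω z), u ∈ e'}) y))) * (∑ η : Set (Sym2 (Fin n)), Literature.Probability.Percolation.BHK2006.weight (fun e => ((w e : unitInterval) : ℝ)) η * H (Literature.Probability.Percolation.openEdgeCluster (η \ {e : Sym2 (Fin n) | ∃ u ∈ e, u = z ∨ ∃ e' ∈ (Literature.Probability.Percolation.openEdgeCluster ω z), u ∈ e'}) y)) * Literature.Probability.Percolation.DecisionTree.ind ((Literature.Probability.Percolation.openConn y z)ᶜ) ω)) := by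
  sorry

/-- STUB (lead c7, wave 2; LANDED p169095 as `Theorems.stub_condDisconnTilt`).  **Conditional-disconnection tilt**:
`P(s↔t | C_s avoids X) ≤ P(s↔t | C_s avoids X, u ↮ v)` for `v ∈ X` (BHK 1.4 for the source `s` against the set `X`). -/
theorem stub_condDisconnTilt :
    ∀ (n : ℕ) (w : Sym2 (Fin n) → unitInterval) (X : Finset (Fin n)) (s t u v : Fin n), v ∈ X → (Literature.Probability.LatticeModels.prodBernoulli w).real ({ω : Literature.Probability.Percolation.BondConfig (Fin n) | ∀ x ∈ X, ω ∉ Literature.Probability.Percolation.openConn s x} ∩ Literature.Probability.Percolation.openConn s t) * (Literature.Probability.LatticeModels.prodBernoulli w).real ({ω : Literature.Probability.Percolation.BondConfig (Fin n) | ∀ x ∈ X, ω ∉ Literature.Probability.Percolation.openConn s x} ∩ (Literature.Probability.Percolation.openConn u v)ᶜ) ≤ (Literature.Probability.LatticeModels.prodBernoulli w).real ({ω : Literature.Probability.Percolation.BondConfig (Fin n) | ∀ x ∈ X, ω ∉ Literature.Probability.Percolation.openConn s x} ∩ Literature.Probability.Percolation.openConn s t ∩ (Literature.Probability.Percolation.openConn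 u v)ᶜ) * (Literature.Probability.LatticeModels.prodBernoulli w).real {ω : Literature.Probability.Percolation.BondConfig (Fin n) | ∀ x ∈ X, ω ∉ Literature.Probability.Percolation.openConn s x} :=
  Summit.CriticalPhenomena.PercolationContinuityZ3.Theorems.stub_condDisconnTilt

/-- STUB (lead c7, wave 2; LANDED p169179 as `Theorems.stub_u1M`).  **U1-M** (the `b = x` case of S1/S2 at θ_M, KN Lemma 2
conditioned): `P(o↔y | x↔y, y↮z) − P(o↔y | y↮x, y↮z) ≥ θ_M` (Harris under `{z ↮ {x,y}}` via `stub_bhkSets.1` + tilt). -/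
theorem stub_u1M :
    ∀ (n : ℕ) (w : Sym2 (Fin n) → unitInterval) (o x y z : Fin n), x ≠ y → x ≠ z → y ≠ z → (Literature.Probability.LatticeModels.prodBernoulli w).real (Literature.Probability.Percolation.openConn o x ∩ ((Literature.Probability.Percolation.openConn x y)ᶜ ∩ (Literature.Probability.Percolation.openConn x z)ᶜ ∩ (Literature.Probability.Percolation.openConn y z)ᶜ)) * ((Literature.Probability.LatticeModels.prodBernoulli w).real (Literature.Probability.Percolation.openConn x y ∩ (Literature.Probability.Percolation.openConn y z)ᶜ) * (Literature.Probability.LatticeModels.prodBernoulli w).real ((Literature.Probability.Percolation.openConn y x)ᶜ ∩ (Literature.Probability.Percolation.openConn y z)ᶜ)) ≤ (Literature.Probability.LatticeModels.prodBernoulli w).real ((Literature.Probability.Percolation.openConn x y)ᶜ ∩ (Literature.Probability.Percolation.openConn x z)ᶜ ∩ (Literature.Probability.Percolation.openConn y z)ᶜ) * ((Literature.Probability.LatticeModels.prodBernoulli w).real (Literature.Probability.Percolation.openConn o y ∩ Literature.Probability.Percolation.openConn x y ∩ (Literature.Probability.Percolation.openConn y z)ᶜ) * (Literature.Probability.LatticeModels.prodBernoulli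 w).real ((Literature.Probability.Percolation.openConn y x)ᶜ ∩ (Literature.Probability.Percolation.openConn y z)ᶜ) - (Literature.Probability.LatticeModels.prodBernoulli w).real (Literature.Probability.Percolation.openConn o y ∩ ((Literature.Probability.Percolation.openConn y x)ᶜ ∩ (Literature.Probability.Percolation.openConn y z)ᶜ)) * (Literature.Probability.LatticeModels.prodBernoulli w).real (Literature.Probability.Percolation.openConn x y ∩ (Literature.Probability.Percolation.openConn y z)ᶜ)) :=
  Summit.CriticalPhenomena.PercolationContinuityZ3.Theorems.stub_u1M

/-- STUB (lead c6; OPEN, conjecture-level with 0 violations; the `F = 1{y ↔ b}` instance of the exchange inequality).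
**Exchange slack S1.** `μ(W)·σ₁({x↔y}) ≤ μ(D_a)·σ₁({o↔y})`. -/
theorem stub_exchS1 :
    ∀ (n : ℕ) (w : Sym2 (Fin n) → unitInterval) (o b x y z : Fin n), x ≠ y → x ≠ z → y ≠ z → (Literature.Probability.LatticeModels.prodBernoulli w).real (((Literature.Probability.Percolation.openConn x y)ᶜ ∩ (Literature.Probability.Percolation.openConn x z)ᶜ) ∩ Literature.Probability.Percolation.openConn o x) * ((Literature.Probability.LatticeModels.prodBernoulli w).real (Literature.Probability.Percolation.openConn y z)ᶜ * (Literature.Probability.LatticeModels.prodBernoulli w).real (Literature.Probability.Percolation.openConn x y ∩ Literature.Probability.Percolation.openConn y b ∩ (Literature.Probability.Percolation.openConn y z)ᶜ) - (Literature.Probability.LatticeModels.prodBernoulli w).real (Literature.Probability.Percolation.openConn x y ∩ (Literature.Probability.Percolation.openConn y z)ᶜ) * (Literature.Probability.LatticeModels.prodBernoulli w).real (Literature.Probability.Percolation.openConn y b ∩ (Literature.Probability.Percolation.openConn y z)ᶜ)) ≤ (Literature.Probability.LatticeModels.prodBernoulli w).real ((Literature.Probability.Percolation.openConn x y)ᶜ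 ∩ (Literature.Probability.Percolation.openConn x z)ᶜ) * ((Literature.Probability.LatticeModels.prodBernoulli w).real (Literature.Probability.Percolation.openConn y z)ᶜ * (Literature.Probability.LatticeModels.prodBernoulli w).real (Literature.Probability.Percolation.openConn o y ∩ Literature.Probability.Percolation.openConn y b ∩ (Literature.Probability.Percolation.openConn y z)ᶜ) - (Literature.Probability.LatticeModels.prodBernoulli w).real (Literature.Probability.Percolation.openConn o y ∩ (Literature.Probability.Percolation.openConn y z)ᶜ) * (Literature.Probability.LatticeModels.prodBernoulli w).real (Literature.Probability.Percolation.openConn y b ∩ (Literature.Probability.Percolation.openConn y z)ᶜ)) :=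
  -- lead c7 wave 4: S1 ∧ S2 ⟸ INNER ≥ 0 (Theorems.exch_stubs_of_innerHole, p171562)
  (Summit.CriticalPhenomena.PercolationContinuityZ3.Theorems.exch_stubs_of_innerHole stub_innerHole).1

/-- STUB (lead c6; OPEN, conjecture-level with 0 violations; the `F = −1{z ↔ b}` instance of the exchange inequality).
**Exchange slack S2.** `μ(W)·σ₂({x↔y}) ≤ μ(D_a)·σ₂({o↔y})`. -/
theorem stub_exchS2 :
    ∀ (n : ℕ) (w : Sym2 (Fin n) → unitInterval) (o b x y z : Fin n), x ≠ y → x ≠ z → y ≠ z → (Literature.Probability.LatticeModels.prodBernoulli w).real (((Literature.Probability.Percolation.openConn x y)ᶜ ∩ (Literature.Probability.Percolation.openConn x z)ᶜ) ∩ Literature.Probability.Percolation.openConn o x) * ((Literature.Probability.LatticeModels.prodBernoulli w).real (Literature.Probability.Percolation.openConn x y ∩ (Literature.Probability.Percolation.openConn y z)ᶜ) * (Literature.Probability.LatticeModels.prodBernoulli w).real (Literature.Probability.Percolation.openConn z b ∩ (Literature.Probability.Percolation.openConn y z)ᶜ) - (Literature.Probability.LatticeModels.prodBernoulli w).real (Literature.Probability.Percolation.openConn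 y z)ᶜ * (Literature.Probability.LatticeModels.prodBernoulli w).real (Literature.Probability.Percolation.openConn x y ∩ Literature.Probability.Percolation.openConn z b ∩ (Literature.Probability.Percolation.openConn y z)ᶜ)) ≤ (Literature.Probability.LatticeModels.prodBernoulli w).real ((Literature.Probability.Percolation.openConn x y)ᶜ ∩ (Literature.Probability.Percolation.openConn x z)ᶜ) * ((Literature.Probability.LatticeModels.prodBernoulli w).real (Literature.Probability.Percolation.openConn o y ∩ (Literature.Probability.Percolation.openConn y z)ᶜ) * (Literature.Probability.LatticeModels.prodBernoulli w).real (Literature.Probability.Percolation.openConn z b ∩ (Literature.Probability.Percolation.openConn y z)ᶜ) - (Literature.Probability.LatticeModels.prodBernoulli w).real (Literature.Probability.Percolation.openConn y z)ᶜ * (Literature.Probability.LatticeModels.prodBernoulli w).real (Literature.Probability.Percolation.openConn o y ∩ Literature.Probability.Percolation.openConn z b ∩ (Literature.Probability.Percolation.openConn y z)ᶜ)) :=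
  -- lead c7 wave 4: S1 ∧ S2 ⟸ INNER ≥ 0 (Theorems.exch_stubs_of_innerHole, p171562); wave-3 route S2 ⟸ S2_M is …S2OfS2M (p169254)
  (Summit.CriticalPhenomena.PercolationContinuityZ3.Theorems.exch_stubs_of_innerHole stub_innerHole).2

/-- STUB (lead c6; LANDED p161380 as `Theorems.stub_exch0`).  **The z-free exchange inequality EXCH₀**: for `E` increasing in
the open edge cluster of `c` and `θ′ = P(s ↔ a | a ↮ c)`, `Cov(1{s↔c} − θ′·1{a↔c}, 1_E) ≥ 0` in denominator-free form
(Harris for `{s ↔ {a,c}}` + BHK 1.4 for the clusters of `a`, `c` given `a ↮ c`). -/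
theorem stub_exch0 :
    ∀ (n : ℕ) (w : Sym2 (Fin n) → unitInterval) (s a c : Fin n) (E : Set (Literature.Probability.Percolation.BondConfig (Fin n))), (∀ ω ω', ω ∈ E → Literature.Probability.Percolation.openEdgeCluster ω c ⊆ Literature.Probability.Percolation.openEdgeCluster ω' c → ω' ∈ E) → a ≠ c → (Literature.Probability.LatticeModels.prodBernoulli w).real (Literature.Probability.Percolation.openConn s a ∩ (Literature.Probability.Percolation.openConn a c)ᶜ) * ((Literature.Probability.LatticeModels.prodBernoulli w).real (Literature.Probability.Percolation.openConn a c ∩ E) - (Literature.Probability.LatticeModels.prodBernoulli w).real (Literature.Probability.Percolation.openConn a c) * (Literature.Probability.LatticeModels.prodBernoulli w).real E) ≤ (Literature.Probability.LatticeModels.prodBernoulli w).real (Literature.Probability.Percolation.openConn a c)ᶜ * ((Literature.Probability.LatticeModels.prodBernoulli w).real (Literature.Probability.Percolation.openConn s c ∩ E) - (Literature.Probability.LatticeModels.prodBernoulli w).real (Literature.Probability.Percolation.openConn s c) * (Literature.Probability.LatticeModels.prodBernoulli w).real E) :=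
  Summit.CriticalPhenomena.PercolationContinuityZ3.Theorems.stub_exch0

/-- **Kozma–Nitzan Question 7 for three relays, modulo S1 ∧ S2** (real composition through the landed chain
`Theorems.q7Three_of_exchStubs`): if `z` is the least reliable of three distinct relays `x, y, z` then
`μ(z ↔ b, o ↔ A) ≤ μ(o ↔ b, o ↔ A)`, `A = {x, y, z}` — KN (41) with the `r`-minimiser; KN Conjecture 1 for |A| = 3 follows by
Harris (`Theorems.conjOneThree_of_exch`). -/
theorem kn_question7_three {n : ℕ} (w : Sym2 (Fin n) → unitInterval) (o b x y z : Fin n) (hxy : x ≠ y) (hxz : x ≠ z)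
    (hyz : y ≠ z) (hzy : (prodBernoulli w).real (openConn z b) ≤ (prodBernoulli w).real (openConn y b))
    (hzx : (prodBernoulli w).real (openConn z b) ≤ (prodBernoulli w).real (openConn x b)) :
    (prodBernoulli w).real (openConn z b ∩ (openConn o x ∪ openConn o y ∪ openConn o z)) ≤
      (prodBernoulli w).real (openConn o b ∩ (openConn o x ∪ openConn o y ∪ openConn o z)) :=
  Summit.CriticalPhenomena.PercolationContinuityZ3.Theorems.q7Three_of_exchStubs stub_exchS1 stub_exchS2 w o b x y z
    hxy hxz hyz hzy hzx

end Summit.CriticalPhenomena.PercolationContinuityZ3.Cruxes.NearOneGluing.LiveFractionLaplace
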